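import Literature.NumberTheory.Sieve.TernaryDivisorAPCompletion
import Literature.NumberTheory.LFunctions.KloostermanPrimePower
import Literature.NumberTheory.LFunctions.KloostermanSalie
import HarnessLib

/-!
# The hyper-Kloosterman sum `K₂` at prime powers — Smith's bound (3.1) from Deligne at primes — PROVED

Topic `Literature/NumberTheory/Sieve` (companion of `TernaryDivisorAPCompletion.lean`, whose
`K2_bound_of_primePow` reduces Heath-Brown's (3.1) to prime powers and whose
`K2_bound_prime_of_nondegenerate` treats primes).  Source for the statements: Heath-Brown
[HeathBrown1986d3] p. 35, "(3.1) `|K₂(a; q)| ≤ q (a, q) d₃(q)` … Moreover by [27], Theorems 2 and 3,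
we have (3.2) `K₂(p^r a; p^α) = p^{2r}K₂(a; p^{α−r})` (`r < α`), (3.3) `K₂(a; p^α) = 0` (`α ≥ 2`,
`(a, p) = 1`, `p ∣ ∏aᵢ`)" ([27] = R. A. Smith, J. Number Theory 11 (1979) 324–343).  The method is
the `p`-adic stationary phase of `Literature/NumberTheory/LFunctions/KloostermanPrimePower.lean` and
`KloostermanSalie.lean` (Salié; Iwaniec–Kowalski §12.3), run in two variables.  Everything here is
PROVED; the only remaining input for (3.1) is Deligne's bound `|K₂(a; p)| ≤ 3p` (`p ∤ a₁a₂a₃`) at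
PRIME moduli, which enters as an explicit hypothesis of the last two theorems.

## What is formalized (namespace `HeathBrown1986`, `p` prime)

* `card_units_pow_three_eq_one_le`, `card_filter_isUnit_and_pow_three_eq_le`: at most `3` cube roots
  of a unit modulo `p^l` (odd `p`: cyclic unit group; `p = 2`: trivial `3`-torsion);
* `stdAddChar_K2_term`, `K2_eq_stationary_sum`: the two-variable stationary-phase formula
  `K₂(a; p^m) = ∑_{u,u' < p^k, units} e((a₁u + a₂u' + a₃ūū')/p^m) I(a₁ − a₃ū²ū') I(a₂ − a₃ūū'²)`,
  `I(w) = p^l[w ≡ 0 (p^l)]`, `m = k + l ≤ 2k`;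
* **`K2_primePow_eq_zero_of_degenerate`** = (3.3): for `m ≥ 2`, `K₂(a; p^m) = 0` as soon as exactly one
  of `a₁, a₃` or exactly one of `a₂, a₃` is a unit (all `a` with `(a, p) = 1`, `p ∣ a₁a₂a₃`);
* **`norm_K2_even_primePow_le`**: `m = 2l`, `p ∤ a₁a₂a₃`: `|K₂(a; p^m)| ≤ 3 p^m` (the critical pairs
  `u' ≡ a₁ā₂u`, `u³ ≡ a₂a₃ā₁²` number at most `3`: `sum_range_ite_critical_le`);
* odd `m = 2l + 1`, `l ≥ 1` (second order): `sum_stdAddChar_sq_add_mul` (completing the square mod `p`),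
  `norm_sum_sum_stdAddChar_quadratic` (a binary quadratic Gauss sum with unit discriminant has modulus
  exactly `p`), `K2_phase_second_order`, `norm_inner_sum2_le` (for `p ≥ 5` the inner `(t, t')`-sum at an
  admissible pair is a binary Gauss sum of discriminant `−3a₃²w̄⁴w̄'⁴`), `norm_K2_odd_primePow_le_of_inner`,
  **`norm_K2_odd_primePow_le`** (`p ∉ {2, 3}`: `≤ 3p^m`), `norm_K2_odd_primePow_le_crude` (all `p`:
  `≤ 3p^{m+1}`, enough at `p ∈ {2, 3}` since `d₃(p^m) ≥ 10` for `m ≥ 3`);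
* **`K2_primePow_mul_prime`** = (3.2) with `r = 1`: `K₂(p b; p^{n+1}) = p² K₂(b; p^n)` (`n ≥ 1`), via the
  fibre identity `sum_ite_isUnit_comp_castHom`;
* `d3_prime_pow` (`d₃(p^k) = ∑_{j ≤ k}(j + 1)`), `d3_prime_pow_mono`, `three_le_d3_prime_pow`,
  `ten_le_d3_prime_pow`, `isUnit_intCast_iff`, `norm_K2_le_sq`, `norm_K2_intCast_congr`,
  `gcd_prime_eq_of_dvd_iff`;
* **`K2_bound_primePow_of_deligne`**: (3.1) at every prime power, `|K₂(a; p^k)| ≤ p^k (a, p^k) d₃(p^k)`,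
  from Deligne's nondegenerate prime bound alone (strong induction on `k`: `k = 1` by
  `K2_bound_prime_of_nondegenerate`; imprimitive `a` by (3.2); mixed `a` by (3.3); unit `a` by the
  even/odd stationary-phase bounds); **`K2_bound_of_deligne`**: (3.1) for every modulus;
* **`Literature.NumberTheory.Sieve.FouvryTenenbaum2021_lemma413_of_deligne`**: Fouvry–Tenenbaum's
  Lemma 4.13 (ternary divisor function in arithmetic progressions, `D`-twisted) at every level
  `θ < 1/2`, conditionally ONLY on Deligne's bound for `K₂` at primes.

## References

* D. R. Heath-Brown, *The divisor function d₃(n) in arithmetic progressions*, Acta Arith. 47 (1986)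
  29–56, §3 (3.1)–(3.3). [HeathBrown1986d3]
* R. A. Smith, *On n-dimensional Kloosterman sums*, J. Number Theory 11 (1979) 324–343, Thms 2–6.
* P. Deligne, *Cohomologie étale (SGA 4½)*, LNM 569 (1977), Sommes trig. §7.
* H. Iwaniec, E. Kowalski, *Analytic Number Theory*, AMS Coll. Publ. 53 (2004), §12.3.
* É. Fouvry, G. Tenenbaum, Trans. AMS 375 (2022) 245–299, Lemma 4.13. [FouvryTenenbaum2021]
-/

open Finset

noncomputable section

namespace Literature.NumberTheory.Sieve

namespace HeathBrown1986

open Literature.NumberTheory.LFunctions (sum_zmod_eq_sum_range sum_range_mul_eq_sum_sum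
  isUnit_iff_cast_ne_zero isUnit_natCast_iff_not_dvd sum_range_stdAddChar_pow_mul
  isUnit_natCast_add_pow_mul_iff card_filter_range_pow_eq norm_stdAddChar
  ZMod.inv_add_mul_of_sq_eq_zero ZMod.cast_inv_of_isUnit norm_quadGaussSum
  ZMod.inv_add_mul_of_cube_eq_zero exists_eq_pow_mul_of_castHom_eq_zero stdAddChar_pow_sq_mul
  stdAddChar_pow_mul_natCast)

section PrimePow

variable {p : ℕ} [hp : Fact p.Prime]

/-! ### Cube roots of unity and cube roots of a unit modulo `p^l` -/

/-- The `3`-torsion of `(ℤ/p^lℤ)ˣ` has at most `3` elements (odd `p`: the group is cyclic; `p = 2`: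
its order is a power of `2`, so the `3`-torsion is trivial). [folklore] -/
theorem card_units_pow_three_eq_one_le (l : ℕ) :
    ((Finset.univ : Finset (ZMod (p ^ l))ˣ).filter (fun ζ => ζ ^ 3 = 1)).card ≤ 3 := by
  classical
  by_cases hp2 : p = 2
  · -- `p = 2`: the order of `ζ` divides `gcd(3, 2^j) = 1`
    subst hp2
    have hsub : (Finset.univ : Finset (ZMod (2 ^ l))ˣ).filter (fun ζ => ζ ^ 3 = 1) ⊆ {1} := by
      intro ζ hζ
      rw [Finset.mem_filter] at hζ
      rw [Finset.mem_singleton]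
      have h3 : orderOf ζ ∣ 3 := orderOf_dvd_of_pow_eq_one hζ.2
      have hcard : orderOf ζ ∣ Fintype.card (ZMod (2 ^ l))ˣ := orderOf_dvd_card
      rcases Nat.eq_zero_or_pos l with hl | hl
      · subst hl
        have hcard1 : Fintype.card (ZMod (2 ^ 0))ˣ = 1 := by
          rw [ZMod.card_units_eq_totient]; rfl
        rw [hcard1, Nat.dvd_one] at hcard
        exact orderOf_eq_one_iff.mp hcard
      · rw [ZMod.card_units_eq_totient, Nat.totient_prime_pow Nat.prime_two hl] at hcard
        have h2 : orderOf ζ ∣ 2 ^ (l - 1) := by simpa using hcard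
        have hcop : Nat.Coprime 3 (2 ^ (l - 1)) := Nat.Coprime.pow_right _ (by norm_num)
        have : orderOf ζ ∣ Nat.gcd 3 (2 ^ (l - 1)) := Nat.dvd_gcd h3 h2
        rw [Nat.Coprime.gcd_eq_one hcop, Nat.dvd_one] at this
        exact orderOf_eq_one_iff.mp this
    exact (Finset.card_le_card hsub).trans (by simp)
  · haveI : IsCyclic (ZMod (p ^ l))ˣ := ZMod.isCyclic_units_of_prime_pow p hp.out hp2 l
    exact IsCyclic.card_pow_eq_one_le (by norm_num)

/-- **At most three cube roots**: for any `c`, `#{w ∈ ℤ/p^lℤ : w unit, w³ = c} ≤ 3`. [folklore] -/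
theorem card_filter_isUnit_and_pow_three_eq_le (l : ℕ) (c : ZMod (p ^ l)) :
    ((Finset.univ : Finset (ZMod (p ^ l))).filter (fun w => IsUnit w ∧ w ^ 3 = c)).card ≤ 3 := by
  classical
  set S := (Finset.univ : Finset (ZMod (p ^ l))).filter (fun w => IsUnit w ∧ w ^ 3 = c) with hS
  rcases S.eq_empty_or_nonempty with he | ⟨w₀, hw₀⟩
  · rw [he, Finset.card_empty]; norm_num
  rw [hS, Finset.mem_filter] at hw₀
  obtain ⟨_, hu₀, hc₀⟩ := hw₀
  -- inject `S` into the `3`-torsion of the units via `w ↦ unit(w) · unit(w₀)⁻¹`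
  have hinj : S.card ≤ ((Finset.univ : Finset (ZMod (p ^ l))ˣ).filter (fun ζ => ζ ^ 3 = 1)).card := by
    refine Finset.card_le_card_of_injOn (fun w => if h : IsUnit w then h.unit * hu₀.unit⁻¹ else 1)
      (fun w hw => ?_) ?_
    · rw [Finset.mem_coe, hS, Finset.mem_filter] at hw
      obtain ⟨_, hu, hcw⟩ := hw
      rw [Finset.mem_coe, Finset.mem_filter]
      refine ⟨Finset.mem_univ _, ?_⟩
      simp only [dif_pos hu]
      -- `(u u₀⁻¹)³ = c c⁻¹ = 1` in the units
      have h1 : (hu.unit : (ZMod (p ^ l))ˣ) ^ 3 = hu₀.unit ^ 3 := by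
        ext
        rw [Units.val_pow_eq_pow_val, Units.val_pow_eq_pow_val, IsUnit.unit_spec, IsUnit.unit_spec, hcw, hc₀]
      rw [mul_pow, inv_pow, h1, mul_inv_cancel]
    · intro a ha b hb hab
      rw [Finset.mem_coe, hS, Finset.mem_filter] at ha hb
      simp only [dif_pos ha.2.1, dif_pos hb.2.1] at hab
      have := congr_arg (fun u : (ZMod (p ^ l))ˣ => ((u * hu₀.unit : (ZMod (p ^ l))ˣ) : ZMod (p ^ l))) hab
      simp only [inv_mul_cancel_right, IsUnit.unit_spec] at this
      exact this
  exact hinj.trans (card_units_pow_three_eq_one_le l)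

/-! ### Stationary phase for `K₂` at an even prime power -/

/-- **One term of the two-variable stationary phase.** For units `u, u'` mod `p^m`, `m ≤ 2k`,
`x = u + p^k v`, `y = u' + p^k v'`: `x̄ȳ = ūū' − p^k(vū²ū' + v'ūū'²)` (`p^{2k} ≡ 0`), so the phase
`a₁x + a₂y + a₃x̄ȳ` splits as `(a₁u + a₂u' + a₃ūū') + p^k v(a₁ − a₃ū²ū') + p^k v'(a₂ − a₃ūū'²)`. [folklore] -/
theorem stdAddChar_K2_term {k m : ℕ} (hm : m ≤ 2 * k) (a₁ a₂ a₃ : ZMod (p ^ m)) (u u' v v' : ℕ)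
    (hu : IsUnit ((u : ℕ) : ZMod (p ^ m))) (hu' : IsUnit ((u' : ℕ) : ZMod (p ^ m))) :
    (ZMod.stdAddChar (a₁ * ((u + p ^ k * v : ℕ) : ZMod (p ^ m)) +
        a₂ * ((u' + p ^ k * v' : ℕ) : ZMod (p ^ m)) +
        a₃ * (((u + p ^ k * v : ℕ) : ZMod (p ^ m))⁻¹ * ((u' + p ^ k * v' : ℕ) : ZMod (p ^ m))⁻¹)) : ℂ) =
      ZMod.stdAddChar (a₁ * ((u : ℕ) : ZMod (p ^ m)) + a₂ * ((u' : ℕ) : ZMod (p ^ m)) +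
          a₃ * (((u : ℕ) : ZMod (p ^ m))⁻¹ * ((u' : ℕ) : ZMod (p ^ m))⁻¹)) *
        (ZMod.stdAddChar (((p ^ k : ℕ) : ZMod (p ^ m)) * ((v : ℕ) : ZMod (p ^ m)) *
            (a₁ - a₃ * ((u : ℕ) : ZMod (p ^ m))⁻¹ ^ 2 * ((u' : ℕ) : ZMod (p ^ m))⁻¹)) *
          ZMod.stdAddChar (((p ^ k : ℕ) : ZMod (p ^ m)) * ((v' : ℕ) : ZMod (p ^ m)) *
            (a₂ - a₃ * ((u : ℕ) : ZMod (p ^ m))⁻¹ * ((u' : ℕ) : ZMod (p ^ m))⁻¹ ^ 2))) := by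
  have hP : (((p ^ k : ℕ) : ZMod (p ^ m))) ^ 2 = 0 := by
    rw [← Nat.cast_pow, ZMod.natCast_eq_zero_iff, ← pow_mul]
    exact pow_dvd_pow p (by omega)
  have hx : ((u + p ^ k * v : ℕ) : ZMod (p ^ m)) =
      ((u : ℕ) : ZMod (p ^ m)) + ((p ^ k : ℕ) : ZMod (p ^ m)) * ((v : ℕ) : ZMod (p ^ m)) := by
    push_cast; ring
  have hy : ((u' + p ^ k * v' : ℕ) : ZMod (p ^ m)) =
      ((u' : ℕ) : ZMod (p ^ m)) + ((p ^ k : ℕ) : ZMod (p ^ m)) * ((v' : ℕ) : ZMod (p ^ m)) := by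
    push_cast; ring
  rw [hx, hy, ZMod.inv_add_mul_of_sq_eq_zero hu hP, ZMod.inv_add_mul_of_sq_eq_zero hu' hP,
    ← AddChar.map_add_eq_mul, ← AddChar.map_add_eq_mul]
  congr 1
  set P : ZMod (p ^ m) := ((p ^ k : ℕ) : ZMod (p ^ m))
  set U : ZMod (p ^ m) := ((u : ℕ) : ZMod (p ^ m))
  set U' : ZMod (p ^ m) := ((u' : ℕ) : ZMod (p ^ m))
  set V : ZMod (p ^ m) := ((v : ℕ) : ZMod (p ^ m))
  set V' : ZMod (p ^ m) := ((v' : ℕ) : ZMod (p ^ m))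
  linear_combination (a₃ * (V * V' * U⁻¹ ^ 2 * U'⁻¹ ^ 2 - V * U⁻¹ ^ 2 * (U'⁻¹) * 0)) * hP

/-- **The two-variable stationary-phase formula for `K₂(a; p^m)`**, `m = k + l ≤ 2k`:
`K₂ = ∑_{u,u' < p^k, units} e((a₁u + a₂u' + a₃ūū')/p^m) · I(a₁ − a₃ū²ū') · I(a₂ − a₃ūū'²)` with
`I(w) = p^l [w ≡ 0 (mod p^l)]` (the sums over the top digits `v, v'`). [folklore] -/
theorem K2_eq_stationary_sum {k l m : ℕ} (hklm : k + l = m) (hm2 : m ≤ 2 * k) (a₁ a₂ a₃ : ZMod (p ^ m)) :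
    K2 (p ^ m) a₁ a₂ a₃ = ∑ u ∈ range (p ^ k), ∑ u' ∈ range (p ^ k),
      if IsUnit ((u : ℕ) : ZMod (p ^ m)) ∧ IsUnit ((u' : ℕ) : ZMod (p ^ m)) then
        (ZMod.stdAddChar (a₁ * ((u : ℕ) : ZMod (p ^ m)) + a₂ * ((u' : ℕ) : ZMod (p ^ m)) +
            a₃ * (((u : ℕ) : ZMod (p ^ m))⁻¹ * ((u' : ℕ) : ZMod (p ^ m))⁻¹)) : ℂ) *
          ((if ZMod.castHom (pow_dvd_pow p (hklm ▸ Nat.le_add_left l k)) (ZMod (p ^ l))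
                (a₁ - a₃ * ((u : ℕ) : ZMod (p ^ m))⁻¹ ^ 2 * ((u' : ℕ) : ZMod (p ^ m))⁻¹) = 0
              then ((p ^ l : ℕ) : ℂ) else 0) *
            (if ZMod.castHom (pow_dvd_pow p (hklm ▸ Nat.le_add_left l k)) (ZMod (p ^ l))
                (a₂ - a₃ * ((u : ℕ) : ZMod (p ^ m))⁻¹ * ((u' : ℕ) : ZMod (p ^ m))⁻¹ ^ 2) = 0
              then ((p ^ l : ℕ) : ℂ) else 0))
      else 0 := by
  classical
  have hk0 : m = 0 ∨ k ≠ 0 := by omega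
  have hdvd : p ^ l ∣ p ^ m := pow_dvd_pow p (by omega)
  haveI : NeZero (p ^ m) := ⟨pow_ne_zero _ hp.out.ne_zero⟩
  set ψ : ZMod (p ^ m) → ℂ := fun x ↦ (ZMod.stdAddChar x : ℂ) with hψ
  set U : ℕ → ZMod (p ^ m) := fun u ↦ ((u : ℕ) : ZMod (p ^ m)) with hU
  set π := ZMod.castHom hdvd (ZMod (p ^ l)) with hπ
  set P : ZMod (p ^ m) := ((p ^ k : ℕ) : ZMod (p ^ m)) with hPdef
  set Φ : ℕ → ℕ → ZMod (p ^ m) := fun u u' =>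
    a₁ * U u + a₂ * U u' + a₃ * ((U u)⁻¹ * (U u')⁻¹) with hΦ
  set w₁ : ℕ → ℕ → ZMod (p ^ m) := fun u u' => a₁ - a₃ * (U u)⁻¹ ^ 2 * (U u')⁻¹ with hw₁
  set w₂ : ℕ → ℕ → ZMod (p ^ m) := fun u u' => a₂ - a₃ * (U u)⁻¹ * (U u')⁻¹ ^ 2 with hw₂
  set I : ZMod (p ^ m) → ℂ := fun w => if π w = 0 then ((p ^ l : ℕ) : ℂ) else 0 with hI
  have hinner : ∀ u u' : ℕ, IsUnit (U u) → IsUnit (U u') →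
      ∑ v ∈ range (p ^ l), ∑ v' ∈ range (p ^ l),
        (if IsUnit (U (u + p ^ k * v)) ∧ IsUnit (U (u' + p ^ k * v')) then
          ψ (a₁ * U (u + p ^ k * v) + a₂ * U (u' + p ^ k * v') +
            a₃ * ((U (u + p ^ k * v))⁻¹ * (U (u' + p ^ k * v'))⁻¹)) else 0) =
        ψ (Φ u u') * (I (w₁ u u') * I (w₂ u u')) := by
    intro u u' hu hu'
    have e : ∀ v v' : ℕ, (if IsUnit (U (u + p ^ k * v)) ∧ IsUnit (U (u' + p ^ k * v')) then
        ψ (a₁ * U (u + p ^ k * v) + a₂ * U (u' + p ^ k * v') +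
          a₃ * ((U (u + p ^ k * v))⁻¹ * (U (u' + p ^ k * v'))⁻¹)) else 0) =
        ψ (Φ u u') * (ψ (P * U v * w₁ u u') * ψ (P * U v' * w₂ u u')) := by
      intro v v'
      rw [if_pos ⟨(isUnit_natCast_add_pow_mul_iff hk0 u v).mpr hu,
        (isUnit_natCast_add_pow_mul_iff hk0 u' v').mpr hu'⟩]
      exact stdAddChar_K2_term hm2 a₁ a₂ a₃ u u' v v' hu hu'
    refine (Finset.sum_congr rfl fun v _ => Finset.sum_congr rfl fun v' _ => e v v').trans ?_
    have hI₁ : ∑ v ∈ range (p ^ l), ψ (P * U v * w₁ u u') = I (w₁ u u') :=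
      sum_range_stdAddChar_pow_mul hklm (w₁ u u')
    have hI₂ : ∑ v' ∈ range (p ^ l), ψ (P * U v' * w₂ u u') = I (w₂ u u') :=
      sum_range_stdAddChar_pow_mul hklm (w₂ u u')
    rw [← hI₁, ← hI₂, Finset.sum_mul_sum, Finset.mul_sum]
    exact Finset.sum_congr rfl fun v _ => by rw [Finset.mul_sum]
  have hpm : range (p ^ m) = range (p ^ k * p ^ l) := by rw [← pow_add, hklm]
  unfold K2
  rw [sum_zmod_eq_sum_range, hpm, sum_range_mul_eq_sum_sum]
  refine Finset.sum_congr rfl fun u _ => ?_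
  have hy : ∀ v : ℕ, ∑ y : ZMod (p ^ m), (if IsUnit (U (u + p ^ k * v)) ∧ IsUnit y then
      ψ (a₁ * U (u + p ^ k * v) + a₂ * y + a₃ * ((U (u + p ^ k * v))⁻¹ * y⁻¹)) else 0) =
      ∑ u' ∈ range (p ^ k), ∑ v' ∈ range (p ^ l),
        (if IsUnit (U (u + p ^ k * v)) ∧ IsUnit (U (u' + p ^ k * v')) then
          ψ (a₁ * U (u + p ^ k * v) + a₂ * U (u' + p ^ k * v') +
            a₃ * ((U (u + p ^ k * v))⁻¹ * (U (u' + p ^ k * v'))⁻¹)) else 0) := by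
    intro v
    rw [sum_zmod_eq_sum_range, hpm, sum_range_mul_eq_sum_sum]
  refine (Finset.sum_congr rfl fun v _ => hy v).trans ?_
  rw [Finset.sum_comm]
  refine Finset.sum_congr rfl fun u' _ => ?_
  by_cases huu : IsUnit (U u) ∧ IsUnit (U u')
  · rw [if_pos huu]
    exact hinner u u' huu.1 huu.2
  · rw [if_neg huu]
    refine Finset.sum_eq_zero fun v _ => Finset.sum_eq_zero fun v' _ => ?_
    rw [if_neg]
    rintro ⟨h1, h2⟩
    exact huu ⟨(isUnit_natCast_add_pow_mul_iff hk0 u v).mp h1,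
      (isUnit_natCast_add_pow_mul_iff hk0 u' v').mp h2⟩

/-- **(3.3): `K₂(a; p^m) = 0` for `m ≥ 2` when `p` divides some but not all of `a₁, a₂, a₃`** — here in
the form: `p ∣ a₁a₃` but not both, or `p ∣ a₂a₃` but not both (which covers every `a` with
`(a, p) = 1`, `p ∣ a₁a₂a₃`): with `k = m − 1`, `l = 1` one of the linear conditions of
`K2_eq_stationary_sum` is never satisfied. [cite: HeathBrown1986d3, §3 (3.3)] -/
theorem K2_primePow_eq_zero_of_degenerate {m : ℕ} (hm : 2 ≤ m) (a₁ a₂ a₃ : ZMod (p ^ m))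
    (h : (IsUnit a₁ ∧ ¬ IsUnit a₃) ∨ (¬ IsUnit a₁ ∧ IsUnit a₃) ∨
      (IsUnit a₂ ∧ ¬ IsUnit a₃) ∨ (¬ IsUnit a₂ ∧ IsUnit a₃)) :
    K2 (p ^ m) a₁ a₂ a₃ = 0 := by
  classical
  have hklm : (m - 1) + 1 = m := by omega
  have hm2 : m ≤ 2 * (m - 1) := by omega
  have hm0 : m ≠ 0 := by omega
  haveI : NeZero (p ^ m) := ⟨pow_ne_zero _ hp.out.ne_zero⟩
  haveI : Fact (1 < p ^ 1) := ⟨by rw [pow_one]; exact hp.out.one_lt⟩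
  set π := ZMod.castHom (pow_dvd_pow p (hklm ▸ Nat.le_add_left 1 (m - 1))) (ZMod (p ^ 1)) with hπ
  set ρ := ZMod.castHom (dvd_pow_self p hm0) (ZMod p) with hρ
  -- a unit of `ℤ/p^m` is nonzero mod `p^1`
  have hne : ∀ w : ZMod (p ^ m), IsUnit w → π w ≠ 0 := fun w hw => (hw.map π).ne_zero
  -- unit ± non-unit·unit is a unit (read mod `p`)
  have hunit_iff : ∀ x : ZMod (p ^ m), IsUnit x ↔ ρ x ≠ 0 := fun x => isUnit_iff_cast_ne_zero hm0 x
  have key₁ : ∀ y : ZMod (p ^ m), IsUnit y →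
      ((IsUnit a₁ ∧ ¬ IsUnit a₃) ∨ (¬ IsUnit a₁ ∧ IsUnit a₃)) → IsUnit (a₁ - a₃ * y) := by
    intro y hy hcase
    rw [hunit_iff, map_sub, map_mul]
    have hy' : ρ y ≠ 0 := (hunit_iff y).mp hy
    rcases hcase with ⟨h1, h3⟩ | ⟨h1, h3⟩
    · have e3 : ρ a₃ = 0 := by by_contra hh; exact h3 ((hunit_iff a₃).mpr hh)
      rw [e3, zero_mul, sub_zero]; exact (hunit_iff a₁).mp h1
    · have e1 : ρ a₁ = 0 := by by_contra hh; exact h1 ((hunit_iff a₁).mpr hh)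
      rw [e1, zero_sub, neg_ne_zero]
      exact mul_ne_zero ((hunit_iff a₃).mp h3) hy'
  rw [K2_eq_stationary_sum hklm hm2]
  refine Finset.sum_eq_zero fun u _ => Finset.sum_eq_zero fun u' _ => ?_
  by_cases huu : IsUnit ((u : ℕ) : ZMod (p ^ m)) ∧ IsUnit ((u' : ℕ) : ZMod (p ^ m))
  · rw [if_pos huu]
    obtain ⟨hu, hu'⟩ := huu
    have iu : IsUnit (((u : ℕ) : ZMod (p ^ m))⁻¹) :=
      IsUnit.of_mul_eq_one _ (by rw [mul_comm, ZMod.mul_inv_of_unit _ hu])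
    have iu' : IsUnit (((u' : ℕ) : ZMod (p ^ m))⁻¹) :=
      IsUnit.of_mul_eq_one _ (by rw [mul_comm, ZMod.mul_inv_of_unit _ hu'])
    rcases h with hc | hc | hc | hc
    · have hw : IsUnit (a₁ - a₃ * ((u : ℕ) : ZMod (p ^ m))⁻¹ ^ 2 * ((u' : ℕ) : ZMod (p ^ m))⁻¹) := by
        have := key₁ _ ((iu.pow 2).mul iu') (Or.inl hc); rwa [← mul_assoc] at this
      rw [if_neg (hne _ hw), zero_mul, mul_zero]
    · have hw : IsUnit (a₁ - a₃ * ((u : ℕ) : ZMod (p ^ m))⁻¹ ^ 2 * ((u' : ℕ) : ZMod (p ^ m))⁻¹) := by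
        have := key₁ _ ((iu.pow 2).mul iu') (Or.inr hc); rwa [← mul_assoc] at this
      rw [if_neg (hne _ hw), zero_mul, mul_zero]
    · have key₂ : IsUnit (a₂ - a₃ * ((u : ℕ) : ZMod (p ^ m))⁻¹ * ((u' : ℕ) : ZMod (p ^ m))⁻¹ ^ 2) := by
        rw [hunit_iff, map_sub, map_mul, map_mul]
        have e3 : ρ a₃ = 0 := by by_contra hh; exact hc.2 ((hunit_iff a₃).mpr hh)
        rw [e3, zero_mul, zero_mul, sub_zero]; exact (hunit_iff a₂).mp hc.1
      rw [if_neg (hne _ key₂), mul_zero, mul_zero]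
    · have key₂ : IsUnit (a₂ - a₃ * ((u : ℕ) : ZMod (p ^ m))⁻¹ * ((u' : ℕ) : ZMod (p ^ m))⁻¹ ^ 2) := by
        rw [hunit_iff, map_sub, map_mul, map_mul]
        have e2 : ρ a₂ = 0 := by by_contra hh; exact hc.1 ((hunit_iff a₂).mpr hh)
        rw [e2, zero_sub, neg_ne_zero]
        exact mul_ne_zero (mul_ne_zero ((hunit_iff a₃).mp hc.2) ((hunit_iff _).mp iu))
          ((hunit_iff _).mp (iu'.pow 2))
      rw [if_neg (hne _ key₂), mul_zero, mul_zero]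
  · rw [if_neg huu]

/-- **`K₂` at an even prime power, nondegenerate case**: for `p ∤ a₁a₂a₃`,
`|K₂(a₁, a₂, a₃; p^{2l})| ≤ 3 p^{2l}` (stationary phase: the sums over `v, v'` localise on
`a₁ ≡ a₃ū²ū'`, `a₂ ≡ a₃ūū'² (mod p^l)`, i.e. `u' ≡ a₁ā₂u`, `u³ ≡ a₂a₃ā₁²`, at most `3` classes).
This is the even-exponent case of Smith's bound (3.1) at prime powers (`3 ≤ d₃(p^{2l})`).
[cite: HeathBrown1986d3, §3 (3.1)] -/
theorem norm_K2_even_primePow_le {l m : ℕ} (hklm : l + l = m) (a₁ a₂ a₃ : ZMod (p ^ m))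
    (h₁ : IsUnit a₁) (h₂ : IsUnit a₂) (h₃ : IsUnit a₃) :
    ‖K2 (p ^ m) a₁ a₂ a₃‖ ≤ 3 * (p : ℝ) ^ m := by
  classical
  have hm2 : m ≤ 2 * l := by omega
  have hk0 : m = 0 ∨ l ≠ 0 := by omega
  have hdvd : p ^ l ∣ p ^ m := pow_dvd_pow p (by omega)
  haveI : NeZero (p ^ m) := ⟨pow_ne_zero _ hp.out.ne_zero⟩
  set ψ : ZMod (p ^ m) → ℂ := fun x ↦ (ZMod.stdAddChar x : ℂ) with hψ
  set U : ℕ → ZMod (p ^ m) := fun u ↦ ((u : ℕ) : ZMod (p ^ m)) with hU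
  set π := ZMod.castHom hdvd (ZMod (p ^ l)) with hπ
  set P : ZMod (p ^ m) := ((p ^ l : ℕ) : ZMod (p ^ m)) with hPdef
  -- the main phase and the two linear forms
  set Φ : ℕ → ℕ → ZMod (p ^ m) := fun u u' =>
    a₁ * U u + a₂ * U u' + a₃ * ((U u)⁻¹ * (U u')⁻¹) with hΦ
  set w₁ : ℕ → ℕ → ZMod (p ^ m) := fun u u' => a₁ - a₃ * (U u)⁻¹ ^ 2 * (U u')⁻¹ with hw₁
  set w₂ : ℕ → ℕ → ZMod (p ^ m) := fun u u' => a₂ - a₃ * (U u)⁻¹ * (U u')⁻¹ ^ 2 with hw₂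
  set I : ZMod (p ^ m) → ℂ := fun w => if π w = 0 then ((p ^ l : ℕ) : ℂ) else 0 with hI
  -- Step 1: the stationary-phase formula
  have hinner : ∀ u u' : ℕ, IsUnit (U u) → IsUnit (U u') →
      ∑ v ∈ range (p ^ l), ∑ v' ∈ range (p ^ l),
        (if IsUnit (U (u + p ^ l * v)) ∧ IsUnit (U (u' + p ^ l * v')) then
          ψ (a₁ * U (u + p ^ l * v) + a₂ * U (u' + p ^ l * v') +
            a₃ * ((U (u + p ^ l * v))⁻¹ * (U (u' + p ^ l * v'))⁻¹)) else 0) =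
        ψ (Φ u u') * (I (w₁ u u') * I (w₂ u u')) := by
    intro u u' hu hu'
    have e : ∀ v v' : ℕ, (if IsUnit (U (u + p ^ l * v)) ∧ IsUnit (U (u' + p ^ l * v')) then
        ψ (a₁ * U (u + p ^ l * v) + a₂ * U (u' + p ^ l * v') +
          a₃ * ((U (u + p ^ l * v))⁻¹ * (U (u' + p ^ l * v'))⁻¹)) else 0) =
        ψ (Φ u u') * (ψ (P * U v * w₁ u u') * ψ (P * U v' * w₂ u u')) := by
      intro v v'
      rw [if_pos ⟨(isUnit_natCast_add_pow_mul_iff hk0 u v).mpr hu,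
        (isUnit_natCast_add_pow_mul_iff hk0 u' v').mpr hu'⟩]
      exact stdAddChar_K2_term hm2 a₁ a₂ a₃ u u' v v' hu hu'
    refine (Finset.sum_congr rfl fun v _ => Finset.sum_congr rfl fun v' _ => e v v').trans ?_
    have hI₁ : ∑ v ∈ range (p ^ l), ψ (P * U v * w₁ u u') = I (w₁ u u') :=
      sum_range_stdAddChar_pow_mul hklm (w₁ u u')
    have hI₂ : ∑ v' ∈ range (p ^ l), ψ (P * U v' * w₂ u u') = I (w₂ u u') :=
      sum_range_stdAddChar_pow_mul hklm (w₂ u u')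
    rw [← hI₁, ← hI₂, Finset.sum_mul_sum, Finset.mul_sum]
    exact Finset.sum_congr rfl fun v _ => by rw [Finset.mul_sum]
  have hS : K2 (p ^ m) a₁ a₂ a₃ = ∑ u ∈ range (p ^ l), ∑ u' ∈ range (p ^ l),
      if IsUnit (U u) ∧ IsUnit (U u') then ψ (Φ u u') * (I (w₁ u u') * I (w₂ u u')) else 0 := by
    have hpm : range (p ^ m) = range (p ^ l * p ^ l) := by rw [← pow_add, hklm]
    unfold K2
    rw [sum_zmod_eq_sum_range, hpm, sum_range_mul_eq_sum_sum]
    refine Finset.sum_congr rfl fun u _ => ?_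
    -- inner sum over `y`
    have hy : ∀ v : ℕ, ∑ y : ZMod (p ^ m), (if IsUnit (U (u + p ^ l * v)) ∧ IsUnit y then
        ψ (a₁ * U (u + p ^ l * v) + a₂ * y + a₃ * ((U (u + p ^ l * v))⁻¹ * y⁻¹)) else 0) =
        ∑ u' ∈ range (p ^ l), ∑ v' ∈ range (p ^ l),
          (if IsUnit (U (u + p ^ l * v)) ∧ IsUnit (U (u' + p ^ l * v')) then
            ψ (a₁ * U (u + p ^ l * v) + a₂ * U (u' + p ^ l * v') +
              a₃ * ((U (u + p ^ l * v))⁻¹ * (U (u' + p ^ l * v'))⁻¹)) else 0) := by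
      intro v
      rw [sum_zmod_eq_sum_range, hpm, sum_range_mul_eq_sum_sum]
    refine (Finset.sum_congr rfl fun v _ => hy v).trans ?_
    -- swap `v` and `u'`
    rw [Finset.sum_comm]
    refine Finset.sum_congr rfl fun u' _ => ?_
    by_cases huu : IsUnit (U u) ∧ IsUnit (U u')
    · rw [if_pos huu]
      exact hinner u u' huu.1 huu.2
    · rw [if_neg huu]
      refine Finset.sum_eq_zero fun v _ => Finset.sum_eq_zero fun v' _ => ?_
      rw [if_neg]
      rintro ⟨h1, h2⟩
      exact huu ⟨(isUnit_natCast_add_pow_mul_iff hk0 u v).mp h1,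
        (isUnit_natCast_add_pow_mul_iff hk0 u' v').mp h2⟩
  -- Step 2: norms; the condition `Q` on the residues mod `p^l`
  set A₁ := π a₁ with hA₁
  set A₂ := π a₂ with hA₂
  set A₃ := π a₃ with hA₃
  set Q : ZMod (p ^ l) → ZMod (p ^ l) → Prop := fun w w' =>
    IsUnit w ∧ IsUnit w' ∧ A₁ * w ^ 2 * w' = A₃ ∧ A₂ * w * w' ^ 2 = A₃ with hQ
  have hcastU : ∀ u : ℕ, π (U u) = (u : ZMod (p ^ l)) := fun u => by
    rw [hπ, ZMod.castHom_apply, hU]; exact ZMod.cast_natCast hdvd u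
  have hnorm : ‖K2 (p ^ m) a₁ a₂ a₃‖ ≤ ∑ u ∈ range (p ^ l), ∑ u' ∈ range (p ^ l),
      if Q (u : ZMod (p ^ l)) (u' : ZMod (p ^ l)) then ((p ^ l : ℕ) : ℝ) * ((p ^ l : ℕ) : ℝ) else 0 := by
    rw [hS]
    refine (norm_sum_le _ _).trans (Finset.sum_le_sum fun u _ ↦ ?_)
    refine (norm_sum_le _ _).trans (Finset.sum_le_sum fun u' _ ↦ ?_)
    by_cases huu : IsUnit (U u) ∧ IsUnit (U u')
    · rw [if_pos huu]
      by_cases h0 : π (w₁ u u') = 0 ∧ π (w₂ u u') = 0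
      · have hQu : Q (u : ZMod (p ^ l)) (u' : ZMod (p ^ l)) := by
          have k1 := huu.1.map π
          have k2 := huu.2.map π
          rw [hcastU] at k1 k2
          set w : ZMod (p ^ l) := (u : ZMod (p ^ l)) with hw
          set w' : ZMod (p ^ l) := (u' : ZMod (p ^ l)) with hw'
          have hinv1 : π ((U u)⁻¹) = w⁻¹ := by
            rw [hπ, ZMod.castHom_apply, ZMod.cast_inv_of_isUnit hdvd huu.1, hU, ZMod.cast_natCast hdvd]
          have hinv2 : π ((U u')⁻¹) = w'⁻¹ := by
            rw [hπ, ZMod.castHom_apply, ZMod.cast_inv_of_isUnit hdvd huu.2, hU, ZMod.cast_natCast hdvd]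
          have i1 : w * w⁻¹ = 1 := ZMod.mul_inv_of_unit _ k1
          have i2 : w' * w'⁻¹ = 1 := ZMod.mul_inv_of_unit _ k2
          have e1 : A₁ = A₃ * w⁻¹ ^ 2 * w'⁻¹ := by
            have := h0.1
            rw [hw₁, map_sub, sub_eq_zero, map_mul, map_mul, map_pow, hinv1, hinv2] at this
            exact this
          have e2 : A₂ = A₃ * w⁻¹ * w'⁻¹ ^ 2 := by
            have := h0.2
            rw [hw₂, map_sub, sub_eq_zero, map_mul, map_mul, map_pow, hinv1, hinv2] at this
            exact this
          refine ⟨k1, k2, ?_, ?_⟩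
          · linear_combination (w ^ 2 * w') * e1 + (A₃ * (w * w⁻¹ * (w' * w'⁻¹) + w' * w'⁻¹)) * i1 + A₃ * i2
          · linear_combination (w * w' ^ 2) * e2 + (A₃ * (w * w⁻¹ * (w' * w'⁻¹) + w * w⁻¹)) * i2 + A₃ * i1
        simp only [hI]
        rw [if_pos h0.1, if_pos h0.2, if_pos hQu, norm_mul, norm_mul, hψ, norm_stdAddChar, one_mul,
          Complex.norm_natCast]
      · have : I (w₁ u u') * I (w₂ u u') = 0 := by
          simp only [hI]
          rcases not_and_or.mp h0 with h | h
          · rw [if_neg h, zero_mul]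
          · rw [if_neg h, mul_zero]
        rw [this, mul_zero, norm_zero]
        split_ifs <;> positivity
    · rw [if_neg huu, norm_zero]
      split_ifs <;> positivity
  -- Step 3: counting: `#Q ≤ 3`
  have hA₁u : IsUnit A₁ := h₁.map π
  have hA₂u : IsUnit A₂ := h₂.map π
  have hA₃u : IsUnit A₃ := h₃.map π
  have hQcount : ((Finset.univ : Finset (ZMod (p ^ l) × ZMod (p ^ l))).filter
      (fun ww => Q ww.1 ww.2)).card ≤ 3 := by
    set c : ZMod (p ^ l) := A₃ * A₂ * (A₁⁻¹ * A₁⁻¹) with hc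
    have iA₁ : A₁ * A₁⁻¹ = 1 := ZMod.mul_inv_of_unit _ hA₁u
    have iA₂ : A₂ * A₂⁻¹ = 1 := ZMod.mul_inv_of_unit _ hA₂u
    have hkey : ∀ w w' : ZMod (p ^ l), Q w w' → w' = A₁ * A₂⁻¹ * w ∧ (IsUnit w ∧ w ^ 3 = c) := by
      intro w w' hq
      obtain ⟨hw, hw', f1, f2⟩ := hq
      have e3 : (A₁ * w) * (w * w') = (A₂ * w') * (w * w') := by linear_combination f1 - f2
      have e4 : A₁ * w = A₂ * w' := (hw.mul hw').mul_right_cancel e3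
      have e5 : w' = A₁ * A₂⁻¹ * w := by linear_combination (-A₂⁻¹) * e4 + (-w') * iA₂
      refine ⟨e5, hw, ?_⟩
      have g1 : A₁ * w ^ 2 * (A₁ * A₂⁻¹ * w) = A₃ := by rw [← e5]; exact f1
      rw [hc]
      linear_combination (A₂ * A₁⁻¹ * A₁⁻¹) * g1 +
        (-(w ^ 3) * (A₁ * A₁⁻¹ * (A₂⁻¹ * A₂) + A₂⁻¹ * A₂)) * iA₁ + (-(w ^ 3)) * iA₂
    calc ((Finset.univ : Finset (ZMod (p ^ l) × ZMod (p ^ l))).filter (fun ww => Q ww.1 ww.2)).card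
        ≤ ((Finset.univ : Finset (ZMod (p ^ l))).filter (fun w => IsUnit w ∧ w ^ 3 = c)).card := by
          refine Finset.card_le_card_of_injOn (fun ww => ww.1) (fun ww hww => ?_) ?_
          · rw [Finset.mem_coe, Finset.mem_filter] at hww
            rw [Finset.mem_coe, Finset.mem_filter]
            exact ⟨Finset.mem_univ _, (hkey _ _ hww.2).2⟩
          · intro a ha b hb hab
            rw [Finset.mem_coe, Finset.mem_filter] at ha hb
            have ea := (hkey _ _ ha.2).1
            have eb := (hkey _ _ hb.2).1
            simp only at hab
            refine Prod.ext hab ?_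
            rw [ea, eb, hab]
      _ ≤ 3 := card_filter_isUnit_and_pow_three_eq_le l c
  -- Step 4: assemble
  have hcount : ∑ u ∈ range (p ^ l), ∑ u' ∈ range (p ^ l),
      (if Q (u : ZMod (p ^ l)) (u' : ZMod (p ^ l)) then ((p ^ l : ℕ) : ℝ) * ((p ^ l : ℕ) : ℝ) else 0) ≤
      3 * (p : ℝ) ^ m := by
    have e : ∑ u ∈ range (p ^ l), ∑ u' ∈ range (p ^ l),
        (if Q (u : ZMod (p ^ l)) (u' : ZMod (p ^ l)) then ((p ^ l : ℕ) : ℝ) * ((p ^ l : ℕ) : ℝ) else 0) =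
        ∑ ww : ZMod (p ^ l) × ZMod (p ^ l),
          (if Q ww.1 ww.2 then ((p ^ l : ℕ) : ℝ) * ((p ^ l : ℕ) : ℝ) else 0) := by
      rw [← sum_zmod_eq_sum_range (fun w : ZMod (p ^ l) => ∑ u' ∈ range (p ^ l),
        (if Q w (u' : ZMod (p ^ l)) then ((p ^ l : ℕ) : ℝ) * ((p ^ l : ℕ) : ℝ) else 0))]
      rw [Fintype.sum_prod_type]
      refine Finset.sum_congr rfl fun w _ => ?_
      exact (sum_zmod_eq_sum_range (fun w' : ZMod (p ^ l) =>
        (if Q w w' then ((p ^ l : ℕ) : ℝ) * ((p ^ l : ℕ) : ℝ) else 0))).symm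
    rw [e, ← Finset.sum_filter, Finset.sum_const, nsmul_eq_mul]
    have hc3 : (((Finset.univ : Finset (ZMod (p ^ l) × ZMod (p ^ l))).filter
        (fun ww => Q ww.1 ww.2)).card : ℝ) ≤ 3 := by exact_mod_cast hQcount
    have : ((p ^ l : ℕ) : ℝ) * ((p ^ l : ℕ) : ℝ) = (p : ℝ) ^ m := by
      push_cast; rw [← pow_add, hklm]
    rw [this]
    exact mul_le_mul_of_nonneg_right hc3 (by positivity)
  exact hnorm.trans hcount

/-! ### Quadratic Gauss sums modulo `p`: completing the square, and the binary case -/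

/-- `4A` is a unit modulo an odd prime when `A` is. [folklore] -/
theorem isUnit_four_mul (hp2 : p ≠ 2) {A : ZMod (p ^ 1)} (hA : IsUnit A) : IsUnit (4 * A) := by
  have h2 : IsUnit ((2 : ℕ) : ZMod (p ^ 1)) := by
    rw [isUnit_natCast_iff_not_dvd one_ne_zero]
    intro h
    exact hp2 ((Nat.prime_dvd_prime_iff_eq hp.out Nat.prime_two).mp h)
  have : (4 : ZMod (p ^ 1)) = ((2 : ℕ) : ZMod (p ^ 1)) * ((2 : ℕ) : ZMod (p ^ 1)) := by norm_num
  rw [this]; exact (h2.mul h2).mul hA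

/-- **Completing the square**: for odd `p` and a unit `A`,
`∑_t e((A t² + β t)/p) = e(−β²/(4A) / p) ∑_t e(A t²/p)`. [folklore] -/
theorem sum_stdAddChar_sq_add_mul (hp2 : p ≠ 2) {A : ZMod (p ^ 1)} (hA : IsUnit A) (β : ZMod (p ^ 1)) :
    ∑ t : ZMod (p ^ 1), (ZMod.stdAddChar (A * t ^ 2 + β * t) : ℂ) =
      (ZMod.stdAddChar (-(β ^ 2 * (4 * A)⁻¹)) : ℂ) * ∑ t : ZMod (p ^ 1), (ZMod.stdAddChar (A * t ^ 2) : ℂ) := by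
  have i4 : (4 * A) * (4 * A)⁻¹ = 1 := ZMod.mul_inv_of_unit _ (isUnit_four_mul hp2 hA)
  set h : ZMod (p ^ 1) := 2 * β * (4 * A)⁻¹ with hh
  rw [← Equiv.sum_comp (Equiv.subRight h) (fun t : ZMod (p ^ 1) => (ZMod.stdAddChar (A * t ^ 2 + β * t) : ℂ)),
    Finset.mul_sum]
  refine Finset.sum_congr rfl fun s _ => ?_
  rw [Equiv.subRight_apply, ← AddChar.map_add_eq_mul]
  congr 1
  linear_combination (-(s * β) + β ^ 2 * (4 * A)⁻¹) * i4

/-- **A nondegenerate binary quadratic Gauss sum has modulus `p`**: for odd `p`, `A` a unit and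
`B² − 4AC` a unit, `|∑_{t,t'} e((A t² + B t t' + C t'² + σ₁ t + σ₂ t')/p)| = p` (complete the
square in `t`, then in `t'`). [folklore] -/
theorem norm_sum_sum_stdAddChar_quadratic (hp2 : p ≠ 2) {A B C : ZMod (p ^ 1)} (hA : IsUnit A)
    (hΔ : IsUnit (B ^ 2 - 4 * A * C)) (σ₁ σ₂ : ZMod (p ^ 1)) :
    ‖∑ t : ZMod (p ^ 1), ∑ t' : ZMod (p ^ 1),
        (ZMod.stdAddChar (A * t ^ 2 + B * t * t' + C * t' ^ 2 + σ₁ * t + σ₂ * t') : ℂ)‖ = p := by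
  have i4 : (4 * A) * (4 * A)⁻¹ = 1 := ZMod.mul_inv_of_unit _ (isUnit_four_mul hp2 hA)
  set ψ : ZMod (p ^ 1) → ℂ := fun x => (ZMod.stdAddChar x : ℂ) with hψ
  set g : ℂ := ∑ t : ZMod (p ^ 1), ψ (A * t ^ 2) with hg
  set C' : ZMod (p ^ 1) := C - B ^ 2 * (4 * A)⁻¹ with hC'
  set σ' : ZMod (p ^ 1) := σ₂ - 2 * B * σ₁ * (4 * A)⁻¹ with hσ'
  set κ : ZMod (p ^ 1) := -(σ₁ ^ 2 * (4 * A)⁻¹) with hκ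
  -- the sum over `t` for fixed `t'`
  have hinner : ∀ t' : ZMod (p ^ 1), ∑ t : ZMod (p ^ 1),
      ψ (A * t ^ 2 + B * t * t' + C * t' ^ 2 + σ₁ * t + σ₂ * t') =
      g * ψ (C' * t' ^ 2 + σ' * t' + κ) := by
    intro t'
    have e : ∀ t : ZMod (p ^ 1), ψ (A * t ^ 2 + B * t * t' + C * t' ^ 2 + σ₁ * t + σ₂ * t') =
        ψ (A * t ^ 2 + (B * t' + σ₁) * t) * ψ (C * t' ^ 2 + σ₂ * t') := by
      intro t
      rw [hψ, ← AddChar.map_add_eq_mul]; congr 1; ring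
    rw [Finset.sum_congr rfl fun t _ => e t, ← Finset.sum_mul, sum_stdAddChar_sq_add_mul hp2 hA,
      ← hg]
    rw [show ∀ X Y Z : ℂ, X * Y * Z = Y * (X * Z) from fun X Y Z => by ring]
    congr 1
    rw [hψ, ← AddChar.map_add_eq_mul]
    congr 1
    rw [hC', hσ', hκ]; ring
  rw [Finset.sum_comm, Finset.sum_congr rfl fun t' _ => hinner t', ← Finset.mul_sum]
  -- `∑_{t'} ψ(C' t'² + σ' t' + κ) = ψ κ ∑ ψ(C' t'² + σ' t')`
  have hsplit : ∑ t' : ZMod (p ^ 1), ψ (C' * t' ^ 2 + σ' * t' + κ) =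
      ψ κ * ∑ t' : ZMod (p ^ 1), ψ (C' * t' ^ 2 + σ' * t') := by
    rw [Finset.mul_sum]
    refine Finset.sum_congr rfl fun t' _ => ?_
    rw [hψ, ← AddChar.map_add_eq_mul, add_comm]
  have hC'u : IsUnit C' := by
    have : C' * (4 * A) = -(B ^ 2 - 4 * A * C) := by
      rw [hC']; linear_combination (-(B ^ 2)) * i4
    exact isUnit_of_mul_isUnit_left (by rw [this]; exact hΔ.neg)
  have hgn : ‖g‖ = Real.sqrt p := by
    have : g = ∑ t : ZMod (p ^ 1), ψ (A * t ^ 2 + 0 * t) := by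
      refine Finset.sum_congr rfl fun t _ => ?_; rw [zero_mul, add_zero]
    rw [this]; exact norm_quadGaussSum hp2 hA 0
  rw [hsplit, norm_mul, norm_mul, hgn, hψ, norm_stdAddChar, one_mul, norm_quadGaussSum hp2 hC'u σ',
    Real.mul_self_sqrt (Nat.cast_nonneg p)]

/-! ### Odd exponent `m = 2l + 1`: second-order stationary phase for `K₂` -/

omit hp in
/-- **The two-variable phase to second order**: with `P³ = 0`, units `W, W'`,
`a₁ − a₃W̄²W̄' = P s₁`, `a₂ − a₃W̄W̄'² = P s₂`, one has
`a₁(W + Pt) + a₂(W' + Pt') + a₃ (W + Pt)⁻¹(W' + Pt')⁻¹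
  = (a₁W + a₂W' + a₃W̄W̄') + P²(s₁t + s₂t' + a₃(W̄³W̄' t² + W̄²W̄'² tt' + W̄W̄'³ t'²))`. [folklore] -/
theorem K2_phase_second_order {q : ℕ} {W W' P a₁ a₂ a₃ s₁ s₂ : ZMod q} (hW : IsUnit W)
    (hW' : IsUnit W') (hP : P ^ 3 = 0) (hs₁ : a₁ - a₃ * W⁻¹ ^ 2 * W'⁻¹ = P * s₁)
    (hs₂ : a₂ - a₃ * W⁻¹ * W'⁻¹ ^ 2 = P * s₂) (t t' : ZMod q) :
    a₁ * (W + P * t) + a₂ * (W' + P * t') + a₃ * ((W + P * t)⁻¹ * (W' + P * t')⁻¹) =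
      (a₁ * W + a₂ * W' + a₃ * (W⁻¹ * W'⁻¹)) +
        P ^ 2 * (s₁ * t + s₂ * t' +
          a₃ * (W⁻¹ ^ 3 * W'⁻¹ * t ^ 2 + W⁻¹ ^ 2 * W'⁻¹ ^ 2 * t * t' + W⁻¹ * W'⁻¹ ^ 3 * t' ^ 2)) := by
  rw [ZMod.inv_add_mul_of_cube_eq_zero hW hP t, ZMod.inv_add_mul_of_cube_eq_zero hW' hP t']
  linear_combination (P * t) * hs₁ + (P * t') * hs₂ +
    (a₃ * (-(t * t' ^ 2 * W⁻¹ ^ 2 * W'⁻¹ ^ 3) - t ^ 2 * t' * W⁻¹ ^ 3 * W'⁻¹ ^ 2 +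
      P * t ^ 2 * t' ^ 2 * W⁻¹ ^ 3 * W'⁻¹ ^ 3)) * hP

/-- `3` is a unit modulo a prime `p ≠ 3`. [folklore] -/
theorem isUnit_three (hp3 : p ≠ 3) : IsUnit (3 : ZMod (p ^ 1)) := by
  have h3 : IsUnit ((3 : ℕ) : ZMod (p ^ 1)) := by
    rw [isUnit_natCast_iff_not_dvd one_ne_zero]
    intro h
    exact hp3 ((Nat.prime_dvd_prime_iff_eq hp.out Nat.prime_three).mp h)
  have : (3 : ZMod (p ^ 1)) = ((3 : ℕ) : ZMod (p ^ 1)) := by norm_num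
  rw [this]; exact h3

set_option maxHeartbeats 800000 in
/-- **The inner sum for one admissible pair `(w, w')`** (odd exponent `2l + 1`, `l ≥ 1`, `p ≥ 5`,
`a₃` a unit): if `w, w'` are units with `a₁ ≡ a₃w̄²w̄'`, `a₂ ≡ a₃w̄w̄'² (mod p^l)`, then
`|∑_{t,t' < p} e((a₁x + a₂y + a₃x̄ȳ)/p^{2l+1})|`, `x = w + p^l t`, `y = w' + p^l t'`, equals `p`:
it is `e(Φ(w,w')/p^{2l+1})` times a binary quadratic Gauss sum modulo `p` with discriminant
`−3a₃²w̄⁴w̄'⁴`. [folklore] -/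
theorem norm_inner_sum2_le (hp2 : p ≠ 2) (hp3 : p ≠ 3) {l : ℕ} (hl : 1 ≤ l)
    {a₁ a₂ a₃ : ZMod (p ^ (2 * l + 1))} (h₃ : IsUnit a₃) (w w' : ℕ)
    (hw : IsUnit ((w : ℕ) : ZMod (p ^ (2 * l + 1)))) (hw' : IsUnit ((w' : ℕ) : ZMod (p ^ (2 * l + 1))))
    (h01 : ZMod.castHom (pow_dvd_pow p (by omega : l ≤ 2 * l + 1)) (ZMod (p ^ l))
      (a₁ - a₃ * ((w : ℕ) : ZMod (p ^ (2 * l + 1)))⁻¹ ^ 2 * ((w' : ℕ) : ZMod (p ^ (2 * l + 1)))⁻¹) = 0)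
    (h02 : ZMod.castHom (pow_dvd_pow p (by omega : l ≤ 2 * l + 1)) (ZMod (p ^ l))
      (a₂ - a₃ * ((w : ℕ) : ZMod (p ^ (2 * l + 1)))⁻¹ * ((w' : ℕ) : ZMod (p ^ (2 * l + 1)))⁻¹ ^ 2) = 0) :
    ‖∑ t ∈ range p, ∑ t' ∈ range p,
        (ZMod.stdAddChar (a₁ * ((w + p ^ l * t : ℕ) : ZMod (p ^ (2 * l + 1))) +
          a₂ * ((w' + p ^ l * t' : ℕ) : ZMod (p ^ (2 * l + 1))) +
          a₃ * (((w + p ^ l * t : ℕ) : ZMod (p ^ (2 * l + 1)))⁻¹ *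
            ((w' + p ^ l * t' : ℕ) : ZMod (p ^ (2 * l + 1)))⁻¹)) : ℂ)‖ ≤ p := by
  classical
  set W : ZMod (p ^ (2 * l + 1)) := ((w : ℕ) : ZMod (p ^ (2 * l + 1))) with hW
  set W' : ZMod (p ^ (2 * l + 1)) := ((w' : ℕ) : ZMod (p ^ (2 * l + 1))) with hW'
  set Pl : ZMod (p ^ (2 * l + 1)) := ((p ^ l : ℕ) : ZMod (p ^ (2 * l + 1))) with hPl
  set π₁ := ZMod.castHom (pow_dvd_pow p (by omega : 1 ≤ 2 * l + 1)) (ZMod (p ^ 1)) with hπ₁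
  obtain ⟨s₁, hs₁⟩ := exists_eq_pow_mul_of_castHom_eq_zero _ h01
  obtain ⟨s₂, hs₂⟩ := exists_eq_pow_mul_of_castHom_eq_zero _ h02
  have hP3 : Pl ^ 3 = 0 := by
    rw [hPl, ← Nat.cast_pow, ZMod.natCast_eq_zero_iff, ← pow_mul]
    exact pow_dvd_pow p (by omega)
  -- unit inverses
  obtain ⟨uw, huw⟩ := hw
  obtain ⟨uw', huw'⟩ := hw'
  have hWinv : W⁻¹ = ((uw⁻¹ : (ZMod (p ^ (2 * l + 1)))ˣ) : ZMod (p ^ (2 * l + 1))) := by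
    rw [← huw, ZMod.inv_coe_unit]
  have hW'inv : W'⁻¹ = ((uw'⁻¹ : (ZMod (p ^ (2 * l + 1)))ˣ) : ZMod (p ^ (2 * l + 1))) := by
    rw [← huw', ZMod.inv_coe_unit]
  have hWi : IsUnit W⁻¹ := by rw [hWinv]; exact Units.isUnit _
  have hW'i : IsUnit W'⁻¹ := by rw [hW'inv]; exact Units.isUnit _
  -- the coefficients of the quadratic form mod `p`
  set A : ZMod (p ^ 1) := π₁ (a₃ * (W⁻¹ ^ 3 * W'⁻¹)) with hA
  set B : ZMod (p ^ 1) := π₁ (a₃ * (W⁻¹ ^ 2 * W'⁻¹ ^ 2)) with hB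
  set C : ZMod (p ^ 1) := π₁ (a₃ * (W⁻¹ * W'⁻¹ ^ 3)) with hC
  have hAu : IsUnit A := (h₃.mul ((hWi.pow 3).mul hW'i)).map π₁
  have hΔ : IsUnit (B ^ 2 - 4 * A * C) := by
    have e : B ^ 2 - 4 * A * C = -(3 * π₁ (a₃ ^ 2 * (W⁻¹ ^ 4 * W'⁻¹ ^ 4))) := by
      have e1 : B ^ 2 - 4 * A * C = π₁ ((a₃ * (W⁻¹ ^ 2 * W'⁻¹ ^ 2)) ^ 2 -
          4 * (a₃ * (W⁻¹ ^ 3 * W'⁻¹)) * (a₃ * (W⁻¹ * W'⁻¹ ^ 3))) := by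
        rw [hA, hB, hC]; simp only [map_sub, map_mul, map_pow, map_ofNat]
      rw [e1, show (a₃ * (W⁻¹ ^ 2 * W'⁻¹ ^ 2)) ^ 2 - 4 * (a₃ * (W⁻¹ ^ 3 * W'⁻¹)) * (a₃ * (W⁻¹ * W'⁻¹ ^ 3)) =
          -(3 * (a₃ ^ 2 * (W⁻¹ ^ 4 * W'⁻¹ ^ 4))) by ring, map_neg, map_mul, map_ofNat]
    rw [e]
    exact ((isUnit_three hp3).mul (((h₃.pow 2).mul ((hWi.pow 4).mul (hW'i.pow 4))).map π₁)).neg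
  -- each phase
  have hphase : ∀ t t' : ℕ,
      (ZMod.stdAddChar (a₁ * ((w + p ^ l * t : ℕ) : ZMod (p ^ (2 * l + 1))) +
          a₂ * ((w' + p ^ l * t' : ℕ) : ZMod (p ^ (2 * l + 1))) +
          a₃ * (((w + p ^ l * t : ℕ) : ZMod (p ^ (2 * l + 1)))⁻¹ *
            ((w' + p ^ l * t' : ℕ) : ZMod (p ^ (2 * l + 1)))⁻¹)) : ℂ) =
      ZMod.stdAddChar (a₁ * W + a₂ * W' + a₃ * (W⁻¹ * W'⁻¹)) *
        ZMod.stdAddChar (A * ((t : ℕ) : ZMod (p ^ 1)) ^ 2 +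
          B * ((t : ℕ) : ZMod (p ^ 1)) * ((t' : ℕ) : ZMod (p ^ 1)) +
          C * ((t' : ℕ) : ZMod (p ^ 1)) ^ 2 +
          π₁ s₁ * ((t : ℕ) : ZMod (p ^ 1)) + π₁ s₂ * ((t' : ℕ) : ZMod (p ^ 1))) := by
    intro t t'
    have hx : ((w + p ^ l * t : ℕ) : ZMod (p ^ (2 * l + 1))) = W + Pl * ((t : ℕ) : ZMod _) := by
      rw [hW, hPl]; push_cast; ring
    have hy : ((w' + p ^ l * t' : ℕ) : ZMod (p ^ (2 * l + 1))) = W' + Pl * ((t' : ℕ) : ZMod _) := by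
      rw [hW', hPl]; push_cast; ring
    rw [hx, hy, K2_phase_second_order ⟨uw, huw⟩ ⟨uw', huw'⟩ hP3 hs₁ hs₂, AddChar.map_add_eq_mul, hPl,
      stdAddChar_pow_sq_mul l]
    congr 2
    rw [hA, hB, hC]
    simp only [map_add, map_mul, map_pow, map_natCast]
    ring
  rw [Finset.sum_congr rfl fun t _ => Finset.sum_congr rfl fun t' _ => hphase t t']
  simp_rw [← Finset.mul_sum]
  rw [norm_mul, norm_stdAddChar, one_mul, show range p = range (p ^ 1) by rw [pow_one]]
  rw [← sum_zmod_eq_sum_range (fun t : ZMod (p ^ 1) => ∑ t' ∈ range (p ^ 1),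
      (ZMod.stdAddChar (A * t ^ 2 + B * t * ((t' : ℕ) : ZMod (p ^ 1)) +
        C * ((t' : ℕ) : ZMod (p ^ 1)) ^ 2 + π₁ s₁ * t + π₁ s₂ * ((t' : ℕ) : ZMod (p ^ 1))) : ℂ))]
  have : ∀ t : ZMod (p ^ 1), ∑ t' ∈ range (p ^ 1),
      (ZMod.stdAddChar (A * t ^ 2 + B * t * ((t' : ℕ) : ZMod (p ^ 1)) +
        C * ((t' : ℕ) : ZMod (p ^ 1)) ^ 2 + π₁ s₁ * t + π₁ s₂ * ((t' : ℕ) : ZMod (p ^ 1))) : ℂ) =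
      ∑ t' : ZMod (p ^ 1), (ZMod.stdAddChar (A * t ^ 2 + B * t * t' + C * t' ^ 2 + π₁ s₁ * t + π₁ s₂ * t') : ℂ) :=
    fun t => (sum_zmod_eq_sum_range (fun t' : ZMod (p ^ 1) =>
      (ZMod.stdAddChar (A * t ^ 2 + B * t * t' + C * t' ^ 2 + π₁ s₁ * t + π₁ s₂ * t') : ℂ))).symm
  rw [Finset.sum_congr rfl fun t _ => this t, norm_sum_sum_stdAddChar_quadratic hp2 hAu hΔ]

/-- **Counting the critical pairs**: for units `A₁, A₂` modulo `p^l` and any `A₃`, the pairs of units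
`(w, w')` with `A₁w²w' = A₃`, `A₂ww'² = A₃` number at most `3` (`w' = A₁Ā₂w`, `w³ = A₃A₂Ā₁²`);
weighted form over representatives. [folklore] -/
theorem sum_range_ite_critical_le {l : ℕ} {A₁ A₂ : ZMod (p ^ l)} (hA₁ : IsUnit A₁) (hA₂ : IsUnit A₂)
    (A₃ : ZMod (p ^ l)) {X : ℝ} (hX : 0 ≤ X) :
    ∑ u ∈ range (p ^ l), ∑ u' ∈ range (p ^ l),
      (if IsUnit ((u : ℕ) : ZMod (p ^ l)) ∧ IsUnit ((u' : ℕ) : ZMod (p ^ l)) ∧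
          A₁ * ((u : ℕ) : ZMod (p ^ l)) ^ 2 * ((u' : ℕ) : ZMod (p ^ l)) = A₃ ∧
          A₂ * ((u : ℕ) : ZMod (p ^ l)) * ((u' : ℕ) : ZMod (p ^ l)) ^ 2 = A₃ then X else 0) ≤ 3 * X := by
  classical
  set Q : ZMod (p ^ l) → ZMod (p ^ l) → Prop := fun w w' =>
    IsUnit w ∧ IsUnit w' ∧ A₁ * w ^ 2 * w' = A₃ ∧ A₂ * w * w' ^ 2 = A₃ with hQ
  have hQcount : ((Finset.univ : Finset (ZMod (p ^ l) × ZMod (p ^ l))).filter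
      (fun ww => Q ww.1 ww.2)).card ≤ 3 := by
    set c : ZMod (p ^ l) := A₃ * A₂ * (A₁⁻¹ * A₁⁻¹) with hc
    have iA₁ : A₁ * A₁⁻¹ = 1 := ZMod.mul_inv_of_unit _ hA₁
    have iA₂ : A₂ * A₂⁻¹ = 1 := ZMod.mul_inv_of_unit _ hA₂
    have hkey : ∀ w w' : ZMod (p ^ l), Q w w' → w' = A₁ * A₂⁻¹ * w ∧ (IsUnit w ∧ w ^ 3 = c) := by
      intro w w' hq
      obtain ⟨hw, hw', f1, f2⟩ := hq
      have e3 : (A₁ * w) * (w * w') = (A₂ * w') * (w * w') := by linear_combination f1 - f2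
      have e4 : A₁ * w = A₂ * w' := (hw.mul hw').mul_right_cancel e3
      have e5 : w' = A₁ * A₂⁻¹ * w := by linear_combination (-A₂⁻¹) * e4 + (-w') * iA₂
      refine ⟨e5, hw, ?_⟩
      have g1 : A₁ * w ^ 2 * (A₁ * A₂⁻¹ * w) = A₃ := by rw [← e5]; exact f1
      rw [hc]
      linear_combination (A₂ * A₁⁻¹ * A₁⁻¹) * g1 +
        (-(w ^ 3) * (A₁ * A₁⁻¹ * (A₂⁻¹ * A₂) + A₂⁻¹ * A₂)) * iA₁ + (-(w ^ 3)) * iA₂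
    calc ((Finset.univ : Finset (ZMod (p ^ l) × ZMod (p ^ l))).filter (fun ww => Q ww.1 ww.2)).card
        ≤ ((Finset.univ : Finset (ZMod (p ^ l))).filter (fun w => IsUnit w ∧ w ^ 3 = c)).card := by
          refine Finset.card_le_card_of_injOn (fun ww => ww.1) (fun ww hww => ?_) ?_
          · rw [Finset.mem_coe, Finset.mem_filter] at hww
            rw [Finset.mem_coe, Finset.mem_filter]
            exact ⟨Finset.mem_univ _, (hkey _ _ hww.2).2⟩
          · intro a ha b hb hab
            rw [Finset.mem_coe, Finset.mem_filter] at ha hb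
            have ea := (hkey _ _ ha.2).1
            have eb := (hkey _ _ hb.2).1
            simp only at hab
            refine Prod.ext hab ?_
            rw [ea, eb, hab]
      _ ≤ 3 := card_filter_isUnit_and_pow_three_eq_le l c
  have e : ∑ u ∈ range (p ^ l), ∑ u' ∈ range (p ^ l),
      (if Q (u : ZMod (p ^ l)) (u' : ZMod (p ^ l)) then X else 0) =
      ∑ ww : ZMod (p ^ l) × ZMod (p ^ l), (if Q ww.1 ww.2 then X else 0) := by
    rw [← sum_zmod_eq_sum_range (fun w : ZMod (p ^ l) => ∑ u' ∈ range (p ^ l),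
      (if Q w (u' : ZMod (p ^ l)) then X else 0))]
    rw [Fintype.sum_prod_type]
    refine Finset.sum_congr rfl fun w _ => ?_
    exact (sum_zmod_eq_sum_range (fun w' : ZMod (p ^ l) => (if Q w w' then X else 0))).symm
  change ∑ u ∈ range (p ^ l), ∑ u' ∈ range (p ^ l),
      (if Q (u : ZMod (p ^ l)) (u' : ZMod (p ^ l)) then X else 0) ≤ 3 * X
  rw [e, ← Finset.sum_filter, Finset.sum_const, nsmul_eq_mul]
  have hc3 : (((Finset.univ : Finset (ZMod (p ^ l) × ZMod (p ^ l))).filter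
      (fun ww => Q ww.1 ww.2)).card : ℝ) ≤ 3 := by exact_mod_cast hQcount
  exact mul_le_mul_of_nonneg_right hc3 hX

set_option maxHeartbeats 1600000 in
/-- **Odd exponent, abstract inner bound**: for `m = 2l + 1`, `l ≥ 1`, units `a₁, a₂, a₃`, if every
admissible inner `(t, t')`-sum (see `norm_inner_sum2_le`) has modulus at most `X`, then
`|K₂(a; p^m)| ≤ 3 p^{2l} X`. [folklore] -/
theorem norm_K2_odd_primePow_le_of_inner {l : ℕ} (hl : 1 ≤ l) (a₁ a₂ a₃ : ZMod (p ^ (2 * l + 1)))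
    (h₁ : IsUnit a₁) (h₂ : IsUnit a₂) {X : ℝ} (hX0 : 0 ≤ X)
    (hX : ∀ w w' : ℕ, IsUnit ((w : ℕ) : ZMod (p ^ (2 * l + 1))) →
      IsUnit ((w' : ℕ) : ZMod (p ^ (2 * l + 1))) →
      ZMod.castHom (pow_dvd_pow p (by omega : l ≤ 2 * l + 1)) (ZMod (p ^ l))
        (a₁ - a₃ * ((w : ℕ) : ZMod (p ^ (2 * l + 1)))⁻¹ ^ 2 * ((w' : ℕ) : ZMod (p ^ (2 * l + 1)))⁻¹) = 0 →
      ZMod.castHom (pow_dvd_pow p (by omega : l ≤ 2 * l + 1)) (ZMod (p ^ l))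
        (a₂ - a₃ * ((w : ℕ) : ZMod (p ^ (2 * l + 1)))⁻¹ * ((w' : ℕ) : ZMod (p ^ (2 * l + 1)))⁻¹ ^ 2) = 0 →
      ‖∑ t ∈ range p, ∑ t' ∈ range p,
        (ZMod.stdAddChar (a₁ * ((w + p ^ l * t : ℕ) : ZMod (p ^ (2 * l + 1))) +
          a₂ * ((w' + p ^ l * t' : ℕ) : ZMod (p ^ (2 * l + 1))) +
          a₃ * (((w + p ^ l * t : ℕ) : ZMod (p ^ (2 * l + 1)))⁻¹ *
            ((w' + p ^ l * t' : ℕ) : ZMod (p ^ (2 * l + 1)))⁻¹)) : ℂ)‖ ≤ X) :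
    ‖K2 (p ^ (2 * l + 1)) a₁ a₂ a₃‖ ≤ 3 * (p : ℝ) ^ (2 * l) * X := by
  classical
  have hklm : (l + 1) + l = 2 * l + 1 := by ring
  have hm2 : 2 * l + 1 ≤ 2 * (l + 1) := by omega
  have hdl : p ^ l ∣ p ^ (2 * l + 1) := pow_dvd_pow p (by omega)
  haveI : NeZero (p ^ (2 * l + 1)) := ⟨pow_ne_zero _ hp.out.ne_zero⟩
  set π := ZMod.castHom hdl (ZMod (p ^ l)) with hπ
  set U : ℕ → ZMod (p ^ (2 * l + 1)) := fun u => ((u : ℕ) : ZMod (p ^ (2 * l + 1))) with hU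
  set ψ : ZMod (p ^ (2 * l + 1)) → ℂ := fun x => (ZMod.stdAddChar x : ℂ) with hψ
  set Φ : ℕ → ℕ → ZMod (p ^ (2 * l + 1)) := fun u u' =>
    a₁ * U u + a₂ * U u' + a₃ * ((U u)⁻¹ * (U u')⁻¹) with hΦ
  set w₁ : ℕ → ℕ → ZMod (p ^ (2 * l + 1)) := fun u u' => a₁ - a₃ * (U u)⁻¹ ^ 2 * (U u')⁻¹ with hw₁
  set w₂ : ℕ → ℕ → ZMod (p ^ (2 * l + 1)) := fun u u' => a₂ - a₃ * (U u)⁻¹ * (U u')⁻¹ ^ 2 with hw₂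
  set I : ZMod (p ^ (2 * l + 1)) → ℂ := fun w => if π w = 0 then ((p ^ l : ℕ) : ℂ) else 0 with hI
  set T : ℕ → ℕ → ℂ := fun u u' =>
    if IsUnit (U u) ∧ IsUnit (U u') then ψ (Φ u u') * (I (w₁ u u') * I (w₂ u u')) else 0 with hT
  -- Step 1: stationary formula and digit splitting
  have hS : K2 (p ^ (2 * l + 1)) a₁ a₂ a₃ =
      ∑ w ∈ range (p ^ l), ∑ w' ∈ range (p ^ l), ∑ t ∈ range p, ∑ t' ∈ range p,
        T (w + p ^ l * t) (w' + p ^ l * t') := by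
    rw [K2_eq_stationary_sum hklm hm2 a₁ a₂ a₃]
    change ∑ u ∈ range (p ^ (l + 1)), ∑ u' ∈ range (p ^ (l + 1)), T u u' = _
    rw [show range (p ^ (l + 1)) = range (p ^ l * p) by rw [pow_succ], sum_range_mul_eq_sum_sum]
    refine Finset.sum_congr rfl fun w _ => ?_
    rw [Finset.sum_congr rfl fun t _ => (sum_range_mul_eq_sum_sum (p ^ l) p (fun u' => T (w + p ^ l * t) u')),
      Finset.sum_comm]
  -- Step 2: the polynomial condition `Q` mod `p^l`
  set A₁ := π a₁ with hA₁
  set A₂ := π a₂ with hA₂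
  set A₃ := π a₃ with hA₃
  have hA₁u : IsUnit A₁ := h₁.map π
  have hA₂u : IsUnit A₂ := h₂.map π
  -- casts that do not see `t`
  have hcastU : ∀ w t : ℕ, π (U (w + p ^ l * t)) = ((w : ℕ) : ZMod (p ^ l)) := by
    intro w t
    rw [hπ, map_natCast, Nat.cast_add, Nat.cast_mul, ZMod.natCast_self, zero_mul, add_zero]
  have hunit : ∀ w t : ℕ, IsUnit (U (w + p ^ l * t)) ↔ IsUnit (U w) := fun w t =>
    isUnit_natCast_add_pow_mul_iff (Or.inr (by omega)) w t
  -- per-`(w, w')` bound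
  have hw_bound : ∀ w w' : ℕ,
      ‖∑ t ∈ range p, ∑ t' ∈ range p, T (w + p ^ l * t) (w' + p ^ l * t')‖ ≤
        if IsUnit ((w : ℕ) : ZMod (p ^ l)) ∧ IsUnit ((w' : ℕ) : ZMod (p ^ l)) ∧
            A₁ * ((w : ℕ) : ZMod (p ^ l)) ^ 2 * ((w' : ℕ) : ZMod (p ^ l)) = A₃ ∧
            A₂ * ((w : ℕ) : ZMod (p ^ l)) * ((w' : ℕ) : ZMod (p ^ l)) ^ 2 = A₃
          then ((p : ℝ) ^ l * (p : ℝ) ^ l) * X else 0 := by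
    intro w w'
    have hrhs : 0 ≤ (if IsUnit ((w : ℕ) : ZMod (p ^ l)) ∧ IsUnit ((w' : ℕ) : ZMod (p ^ l)) ∧
            A₁ * ((w : ℕ) : ZMod (p ^ l)) ^ 2 * ((w' : ℕ) : ZMod (p ^ l)) = A₃ ∧
            A₂ * ((w : ℕ) : ZMod (p ^ l)) * ((w' : ℕ) : ZMod (p ^ l)) ^ 2 = A₃
          then ((p : ℝ) ^ l * (p : ℝ) ^ l) * X else 0) := by
      split_ifs <;> positivity
    by_cases huu : IsUnit (U w) ∧ IsUnit (U w')
    · obtain ⟨hu, hu'⟩ := huu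
      -- the inverses mod `p^l` do not see `t`
      have hinv : ∀ v t : ℕ, IsUnit (U v) → π ((U (v + p ^ l * t))⁻¹) = ((v : ℕ) : ZMod (p ^ l))⁻¹ := by
        intro v t hv
        rw [hπ, ZMod.castHom_apply, ZMod.cast_inv_of_isUnit hdl ((hunit v t).mpr hv),
          ← ZMod.castHom_apply (h := hdl) (R := ZMod (p ^ l))]
        rw [← hπ, hcastU]
      have hinv0 : ∀ v : ℕ, IsUnit (U v) → π ((U v)⁻¹) = ((v : ℕ) : ZMod (p ^ l))⁻¹ := by
        intro v hv
        have := hinv v 0 hv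
        simpa using this
      have hcond₁ : ∀ t t' : ℕ, π (w₁ (w + p ^ l * t) (w' + p ^ l * t')) = π (w₁ w w') := by
        intro t t'
        simp only [hw₁, map_sub, map_mul, map_pow]
        rw [hinv w t hu, hinv w' t' hu', hinv0 w hu, hinv0 w' hu']
      have hcond₂ : ∀ t t' : ℕ, π (w₂ (w + p ^ l * t) (w' + p ^ l * t')) = π (w₂ w w') := by
        intro t t'
        simp only [hw₂, map_sub, map_mul, map_pow]
        rw [hinv w t hu, hinv w' t' hu', hinv0 w hu, hinv0 w' hu']
      by_cases h0 : π (w₁ w w') = 0 ∧ π (w₂ w w') = 0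
      · -- admissible: `Q` holds and the inner sum is the Gauss-type sum
        set wl : ZMod (p ^ l) := ((w : ℕ) : ZMod (p ^ l)) with hwl
        set wl' : ZMod (p ^ l) := ((w' : ℕ) : ZMod (p ^ l)) with hwl'
        have k1 : IsUnit wl := by have := hu.map π; rwa [show π (U w) = wl from by
          have := hcastU w 0; simpa using this] at this
        have k2 : IsUnit wl' := by have := hu'.map π; rwa [show π (U w') = wl' from by
          have := hcastU w' 0; simpa using this] at this
        have i1 : wl * wl⁻¹ = 1 := ZMod.mul_inv_of_unit _ k1
        have i2 : wl' * wl'⁻¹ = 1 := ZMod.mul_inv_of_unit _ k2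
        have e1 : A₁ = A₃ * wl⁻¹ ^ 2 * wl'⁻¹ := by
          have := h0.1
          rw [hw₁] at this
          simp only [map_sub, map_mul, map_pow, sub_eq_zero] at this
          rw [hinv0 w hu, hinv0 w' hu'] at this
          exact this
        have e2 : A₂ = A₃ * wl⁻¹ * wl'⁻¹ ^ 2 := by
          have := h0.2
          rw [hw₂] at this
          simp only [map_sub, map_mul, map_pow, sub_eq_zero] at this
          rw [hinv0 w hu, hinv0 w' hu'] at this
          exact this
        have hQw : IsUnit wl ∧ IsUnit wl' ∧ A₁ * wl ^ 2 * wl' = A₃ ∧ A₂ * wl * wl' ^ 2 = A₃ := by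
          refine ⟨k1, k2, ?_, ?_⟩
          · linear_combination (wl ^ 2 * wl') * e1 + (A₃ * (wl * wl⁻¹ * (wl' * wl'⁻¹) + wl' * wl'⁻¹)) * i1 + A₃ * i2
          · linear_combination (wl * wl' ^ 2) * e2 + (A₃ * (wl * wl⁻¹ * (wl' * wl'⁻¹) + wl * wl⁻¹)) * i2 + A₃ * i1
        rw [if_pos hQw]
        -- evaluate `T`
        have hTe : ∀ t t' : ℕ, T (w + p ^ l * t) (w' + p ^ l * t') =
            (((p ^ l : ℕ) : ℂ) * ((p ^ l : ℕ) : ℂ)) * ψ (Φ (w + p ^ l * t) (w' + p ^ l * t')) := by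
          intro t t'
          simp only [hT]
          rw [if_pos ⟨(hunit w t).mpr hu, (hunit w' t').mpr hu'⟩]
          simp only [hI]
          rw [hcond₁ t t', hcond₂ t t', if_pos h0.1, if_pos h0.2, mul_comm]
        rw [Finset.sum_congr rfl fun t _ => Finset.sum_congr rfl fun t' _ => hTe t t']
        simp_rw [← Finset.mul_sum]
        rw [norm_mul, norm_mul, Complex.norm_natCast]
        have hin := hX w w' hu hu' h0.1 h0.2
        push_cast
        exact mul_le_mul_of_nonneg_left hin (by positivity)
      · -- not admissible: every term vanishes
        refine le_of_eq_of_le ?_ hrhs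
        rw [norm_eq_zero]
        refine Finset.sum_eq_zero fun t _ => Finset.sum_eq_zero fun t' _ => ?_
        simp only [hT]
        rw [if_pos ⟨(hunit w t).mpr hu, (hunit w' t').mpr hu'⟩]
        simp only [hI]
        rw [hcond₁ t t', hcond₂ t t']
        rcases not_and_or.mp h0 with h | h
        · rw [if_neg h, zero_mul, mul_zero]
        · rw [if_neg h, mul_zero, mul_zero]
    · -- `w` or `w'` not a unit: every term vanishes
      refine le_of_eq_of_le ?_ hrhs
      rw [norm_eq_zero]
      refine Finset.sum_eq_zero fun t _ => Finset.sum_eq_zero fun t' _ => ?_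
      simp only [hT]
      rw [if_neg]
      rintro ⟨k1, k2⟩
      exact huu ⟨(hunit w t).mp k1, (hunit w' t').mp k2⟩
  -- Step 3: sum over `(w, w')` and count
  rw [hS]
  refine (norm_sum_le _ _).trans ((Finset.sum_le_sum fun w _ => norm_sum_le _ _).trans ?_)
  refine (Finset.sum_le_sum fun w _ => Finset.sum_le_sum fun w' _ => hw_bound w w').trans ?_
  refine (sum_range_ite_critical_le hA₁u hA₂u A₃ (X := ((p : ℝ) ^ l * (p : ℝ) ^ l) * X)
    (by positivity)).trans (le_of_eq ?_)
  rw [← pow_add, show l + l = 2 * l by ring]; ring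

omit hp in
/-- The trivial bound `p²` for the inner `(t, t')`-sum. [folklore] -/
theorem norm_inner_sum2_le_sq {N : ℕ} [NeZero N] (f : ℕ → ℕ → ZMod N) :
    ‖∑ t ∈ range p, ∑ t' ∈ range p, (ZMod.stdAddChar (f t t') : ℂ)‖ ≤ (p : ℝ) * p := by
  refine (norm_sum_le _ _).trans ?_
  refine (Finset.sum_le_sum fun t _ => (norm_sum_le _ _).trans
    (Finset.sum_le_sum fun t' _ => (norm_stdAddChar (f t t')).le)).trans (le_of_eq ?_)
  simp

/-- **`K₂` at an odd prime power `p^{2l+1}`, `l ≥ 1`, `p ≥ 5`, nondegenerate case**: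
`|K₂(a; p^{2l+1})| ≤ 3 p^{2l+1}`. [cite: HeathBrown1986d3, §3 (3.1)] -/
theorem norm_K2_odd_primePow_le (hp2 : p ≠ 2) (hp3 : p ≠ 3) {l : ℕ} (hl : 1 ≤ l)
    (a₁ a₂ a₃ : ZMod (p ^ (2 * l + 1))) (h₁ : IsUnit a₁) (h₂ : IsUnit a₂) (h₃ : IsUnit a₃) :
    ‖K2 (p ^ (2 * l + 1)) a₁ a₂ a₃‖ ≤ 3 * (p : ℝ) ^ (2 * l + 1) := by
  refine (norm_K2_odd_primePow_le_of_inner hl a₁ a₂ a₃ h₁ h₂ (Nat.cast_nonneg p)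
    (fun w w' hw hw' h01 h02 => norm_inner_sum2_le hp2 hp3 hl h₃ w w' hw hw' h01 h02)).trans (le_of_eq ?_)
  rw [pow_succ]; ring

/-- **`K₂` at an odd prime power, any `p`, nondegenerate case, crude form**:
`|K₂(a; p^{2l+1})| ≤ 3 p^{2l+2}` (`l ≥ 1`). [folklore] -/
theorem norm_K2_odd_primePow_le_crude {l : ℕ} (hl : 1 ≤ l)
    (a₁ a₂ a₃ : ZMod (p ^ (2 * l + 1))) (h₁ : IsUnit a₁) (h₂ : IsUnit a₂) :
    ‖K2 (p ^ (2 * l + 1)) a₁ a₂ a₃‖ ≤ 3 * (p : ℝ) ^ (2 * l + 2) := by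
  haveI : NeZero (p ^ (2 * l + 1)) := ⟨pow_ne_zero _ hp.out.ne_zero⟩
  refine (norm_K2_odd_primePow_le_of_inner hl a₁ a₂ a₃ h₁ h₂ (by positivity : (0 : ℝ) ≤ (p : ℝ) * p)
    (fun w w' _ _ _ _ => norm_inner_sum2_le_sq _)).trans (le_of_eq ?_)
  rw [pow_add]; ring

/-! ### (3.2): the imprimitive scaling `K₂(p b; p^{n+1}) = p² K₂(b; p^n)` -/

/-- Fibres of the reduction on units: `∑_{x mod p^{n+1}, unit} G(x mod p^n) = p ∑_{x' mod p^n, unit} G(x')`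
(`n ≥ 1`). [folklore] -/
theorem sum_ite_isUnit_comp_castHom {n : ℕ} (hn : n ≠ 0) (G : ZMod (p ^ n) → ℂ) :
    ∑ x : ZMod (p ^ (n + 1)),
        (if IsUnit x then G (ZMod.castHom (pow_dvd_pow p (Nat.le_succ n)) (ZMod (p ^ n)) x) else 0) =
      (p : ℂ) * ∑ x' : ZMod (p ^ n), (if IsUnit x' then G x' else 0) := by
  classical
  set π := ZMod.castHom (pow_dvd_pow p (Nat.le_succ n)) (ZMod (p ^ n)) with hπ
  rw [sum_zmod_eq_sum_range (fun x : ZMod (p ^ (n + 1)) => if IsUnit x then G (π x) else 0),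
    show range (p ^ (n + 1)) = range (p ^ n * p) by rw [pow_succ], sum_range_mul_eq_sum_sum,
    sum_zmod_eq_sum_range (fun x' : ZMod (p ^ n) => if IsUnit x' then G x' else 0), Finset.mul_sum]
  refine Finset.sum_congr rfl fun w _ => ?_
  have hterm : ∀ v : ℕ, (if IsUnit (((w + p ^ n * v : ℕ) : ZMod (p ^ (n + 1)))) then
      G (π ((w + p ^ n * v : ℕ) : ZMod (p ^ (n + 1)))) else 0) =
      (if IsUnit ((w : ℕ) : ZMod (p ^ n)) then G ((w : ℕ) : ZMod (p ^ n)) else 0) := by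
    intro v
    have hu : IsUnit (((w + p ^ n * v : ℕ) : ZMod (p ^ (n + 1)))) ↔ IsUnit ((w : ℕ) : ZMod (p ^ n)) := by
      rw [isUnit_natCast_add_pow_mul_iff (Or.inr hn), isUnit_natCast_iff_not_dvd (by omega),
        isUnit_natCast_iff_not_dvd hn]
    have hc : π ((w + p ^ n * v : ℕ) : ZMod (p ^ (n + 1))) = ((w : ℕ) : ZMod (p ^ n)) := by
      rw [hπ, map_natCast, Nat.cast_add, Nat.cast_mul, ZMod.natCast_self, zero_mul, add_zero]
    by_cases h : IsUnit ((w : ℕ) : ZMod (p ^ n))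
    · rw [if_pos (hu.mpr h), if_pos h, hc]
    · rw [if_neg (mt hu.mp h), if_neg h]
  rw [Finset.sum_congr rfl fun v _ => hterm v, Finset.sum_const, Finset.card_range, nsmul_eq_mul]

/-- **(3.2)** (`r = 1`): `K₂(p b₁, p b₂, p b₃; p^{n+1}) = p² K₂(b₁, b₂, b₃; p^n)` for `n ≥ 1`.
[cite: HeathBrown1986d3, §3 (3.2)] -/
theorem K2_primePow_mul_prime {n : ℕ} (hn : n ≠ 0) (b₁ b₂ b₃ : ZMod (p ^ (n + 1))) :
    K2 (p ^ (n + 1)) ((p : ZMod (p ^ (n + 1))) * b₁) ((p : ZMod (p ^ (n + 1))) * b₂)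
        ((p : ZMod (p ^ (n + 1))) * b₃) =
      (p : ℂ) ^ 2 * K2 (p ^ n) (ZMod.castHom (pow_dvd_pow p (Nat.le_succ n)) (ZMod (p ^ n)) b₁)
        (ZMod.castHom (pow_dvd_pow p (Nat.le_succ n)) (ZMod (p ^ n)) b₂)
        (ZMod.castHom (pow_dvd_pow p (Nat.le_succ n)) (ZMod (p ^ n)) b₃) := by
  classical
  have hdvd : p ^ n ∣ p ^ (n + 1) := pow_dvd_pow p (Nat.le_succ n)
  set π := ZMod.castHom hdvd (ZMod (p ^ n)) with hπ
  have hklm : 1 + n = n + 1 := by ring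
  set F : ZMod (p ^ n) → ZMod (p ^ n) → ℂ := fun x' y' =>
    (ZMod.stdAddChar (π b₁ * x' + π b₂ * y' + π b₃ * (x'⁻¹ * y'⁻¹)) : ℂ) with hF
  -- the phase for units `x, y`
  have hphase : ∀ x y : ZMod (p ^ (n + 1)), IsUnit x → IsUnit y →
      (ZMod.stdAddChar ((p : ZMod (p ^ (n + 1))) * b₁ * x + (p : ZMod (p ^ (n + 1))) * b₂ * y +
        (p : ZMod (p ^ (n + 1))) * b₃ * (x⁻¹ * y⁻¹)) : ℂ) = F (π x) (π y) := by
    intro x y hx hy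
    set z : ZMod (p ^ (n + 1)) := b₁ * x + b₂ * y + b₃ * (x⁻¹ * y⁻¹) with hz
    have e1 : (p : ZMod (p ^ (n + 1))) * b₁ * x + (p : ZMod (p ^ (n + 1))) * b₂ * y +
        (p : ZMod (p ^ (n + 1))) * b₃ * (x⁻¹ * y⁻¹) = ((p ^ 1 * z.val : ℕ) : ZMod (p ^ (n + 1))) := by
      push_cast
      rw [ZMod.natCast_zmod_val z, hz]
      ring
    have hix : π x⁻¹ = (π x)⁻¹ := by
      rw [hπ, ZMod.castHom_apply, ZMod.castHom_apply, ZMod.cast_inv_of_isUnit hdvd hx]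
    have hiy : π y⁻¹ = (π y)⁻¹ := by
      rw [hπ, ZMod.castHom_apply, ZMod.castHom_apply, ZMod.cast_inv_of_isUnit hdvd hy]
    have e2 : π b₁ * π x + π b₂ * π y + π b₃ * ((π x)⁻¹ * (π y)⁻¹) = ((z.val : ℕ) : ZMod (p ^ n)) := by
      rw [← map_natCast π, ZMod.natCast_zmod_val, hz]
      simp only [map_add, map_mul, hix, hiy]
    rw [e1, stdAddChar_pow_mul_natCast hklm z.val, hF]
    simp only []
    rw [e2]
  -- rewrite the summand
  unfold K2
  have h1 : ∀ x : ZMod (p ^ (n + 1)), ∑ y : ZMod (p ^ (n + 1)),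
      (if IsUnit x ∧ IsUnit y then
        (ZMod.stdAddChar ((p : ZMod (p ^ (n + 1))) * b₁ * x + (p : ZMod (p ^ (n + 1))) * b₂ * y +
          (p : ZMod (p ^ (n + 1))) * b₃ * (x⁻¹ * y⁻¹)) : ℂ) else 0) =
      if IsUnit x then (p : ℂ) * ∑ y' : ZMod (p ^ n), (if IsUnit y' then F (π x) y' else 0) else 0 := by
    intro x
    by_cases hx : IsUnit x
    · rw [if_pos hx, ← sum_ite_isUnit_comp_castHom hn (F (π x))]
      refine Finset.sum_congr rfl fun y _ => ?_
      by_cases hy : IsUnit y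
      · rw [if_pos ⟨hx, hy⟩, if_pos hy, hphase x y hx hy]
      · rw [if_neg (fun h => hy h.2), if_neg hy]
    · rw [if_neg hx]
      exact Finset.sum_eq_zero fun y _ => if_neg (fun h => hx h.1)
  rw [Finset.sum_congr rfl fun x _ => h1 x]
  have h2 := sum_ite_isUnit_comp_castHom hn
    (fun x' => (p : ℂ) * ∑ y' : ZMod (p ^ n), (if IsUnit y' then F x' y' else 0))
  rw [h2, Finset.mul_sum, Finset.mul_sum]
  refine Finset.sum_congr rfl fun x' _ => ?_
  by_cases hx' : IsUnit x'
  · rw [if_pos hx', Finset.mul_sum, Finset.mul_sum, Finset.mul_sum]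
    refine Finset.sum_congr rfl fun y' _ => ?_
    by_cases hy' : IsUnit y'
    · rw [if_pos hy', if_pos ⟨hx', hy'⟩]; ring
    · rw [if_neg hy', if_neg (fun h => hy' h.2)]; ring
  · rw [if_neg hx', mul_zero]
    symm
    rw [Finset.mul_sum]
    refine Finset.sum_eq_zero fun y' _ => ?_
    rw [if_neg (fun h => hx' h.1), mul_zero]

/-! ### `d₃` at prime powers -/

/-- `d₃(p^k) = ∑_{j ≤ k} (j + 1)`. [folklore] -/
theorem d3_prime_pow (k : ℕ) : d3 (p ^ k) = ∑ j ∈ range (k + 1), (j + 1) := by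
  unfold d3
  rw [Nat.sum_divisors_prime_pow hp.out]
  refine Finset.sum_congr rfl fun j _ => ?_
  rw [Nat.divisors_prime_pow hp.out, Finset.card_map, Finset.card_range]

/-- `d₃(p^j) ≤ d₃(p^k)` for `j ≤ k`. [folklore] -/
theorem d3_prime_pow_mono {j k : ℕ} (h : j ≤ k) : d3 (p ^ j) ≤ d3 (p ^ k) := by
  rw [d3_prime_pow, d3_prime_pow]
  exact Finset.sum_le_sum_of_subset (Finset.range_subset_range.mpr (by omega))

/-- `3 ≤ d₃(p^k)` for `k ≥ 1`. [folklore] -/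
theorem three_le_d3_prime_pow {k : ℕ} (hk : 1 ≤ k) : 3 ≤ d3 (p ^ k) := by
  have h := d3_prime_pow_mono (p := p) hk
  rw [d3_prime_pow (p := p) 1] at h
  simpa [Finset.sum_range_succ] using h

/-- `10 ≤ d₃(p^k)` for `k ≥ 3`. [folklore] -/
theorem ten_le_d3_prime_pow {k : ℕ} (hk : 3 ≤ k) : 10 ≤ d3 (p ^ k) := by
  have h := d3_prime_pow_mono (p := p) hk
  rw [d3_prime_pow (p := p) 3] at h
  simpa [Finset.sum_range_succ] using h

/-- Units among integer parameters: for `k ≥ 1`, `(m : ℤ/p^kℤ)` is a unit iff `p ∤ m`. [folklore] -/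
theorem isUnit_intCast_iff {k : ℕ} (hk : k ≠ 0) (m : ℤ) :
    IsUnit ((m : ℤ) : ZMod (p ^ k)) ↔ ¬ p ∣ m.natAbs := by
  rcases Int.natAbs_eq m with h | h
  · rw [h, Int.cast_natCast, Int.natAbs_natCast]
    exact isUnit_natCast_iff_not_dvd hk _
  · rw [h, Int.cast_neg, Int.cast_natCast, IsUnit.neg_iff, Int.natAbs_neg, Int.natAbs_natCast]
    exact isUnit_natCast_iff_not_dvd hk _

end PrimePow

/-- The trivial bound `|K₂(a; q)| ≤ q²`. [folklore] -/
theorem norm_K2_le_sq (q : ℕ) [NeZero q] (a₁ a₂ a₃ : ZMod q) : ‖K2 q a₁ a₂ a₃‖ ≤ (q : ℝ) * q := by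
  classical
  unfold K2
  refine (norm_sum_le _ _).trans ?_
  refine (Finset.sum_le_sum fun x _ => (norm_sum_le _ _).trans
    (Finset.sum_le_sum fun y _ => (?_ : ‖_‖ ≤ (1 : ℝ)))).trans (le_of_eq ?_)
  · split_ifs
    · exact (norm_stdAddChar _).le
    · rw [norm_zero]; exact zero_le_one
  · simp [ZMod.card]

/-- `‖K₂‖` with integer parameters does not depend on how the modulus is written. [folklore] -/
theorem norm_K2_intCast_congr {c c' : ℕ} [NeZero c] [NeZero c'] (h : c = c') (m₁ m₂ m₃ : ℤ) :
    ‖K2 c (m₁ : ZMod c) (m₂ : ZMod c) (m₃ : ZMod c)‖ =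
      ‖K2 c' (m₁ : ZMod c') (m₂ : ZMod c') (m₃ : ZMod c')‖ := by
  subst h; rfl

/-- For a prime `p`, `gcd(X, p) = gcd(Y, p)` as soon as `p ∣ X ↔ p ∣ Y`. [folklore] -/
theorem gcd_prime_eq_of_dvd_iff {p X Y : ℕ} (hp : p.Prime) (h : p ∣ X ↔ p ∣ Y) :
    Nat.gcd X p = Nat.gcd Y p := by
  rcases Nat.coprime_or_dvd_of_prime hp X with hc | hd
  · have hY : ¬ p ∣ Y := fun hy => (Nat.Prime.coprime_iff_not_dvd hp).mp hc (h.mpr hy)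
    rw [hc.symm.gcd_eq_one, ((Nat.Prime.coprime_iff_not_dvd hp).mpr hY).symm.gcd_eq_one]
  · rw [Nat.gcd_eq_right hd, Nat.gcd_eq_right (h.mp hd)]

set_option maxHeartbeats 800000 in
/-- **Smith's bound (3.1) at prime powers from Deligne's bound at primes.** If
`|K₂(a₁, a₂, a₃; p)| ≤ 3p` for every prime `p` and all `p ∤ a₁a₂a₃` (Deligne), then
`|K₂(a; p^k)| ≤ p^k (a, p^k) d₃(p^k)` for every prime power: `k = 1` by the degenerate evaluations
(`K2_bound_prime_of_nondegenerate`), `k ≥ 2` by (3.2) and induction when `p ∣ (a₁, a₂, a₃)`, by (3.3)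
in the mixed case, and by the stationary-phase bounds `norm_K2_even_primePow_le`,
`norm_K2_odd_primePow_le(_crude)` when `p ∤ a₁a₂a₃`. [cite: HeathBrown1986d3, §3 (3.1)–(3.3)] -/
theorem K2_bound_primePow_of_deligne
    (hD : ∀ (p : ℕ) [Fact p.Prime] (a₁ a₂ a₃ : ZMod p), a₁ ≠ 0 → a₂ ≠ 0 → a₃ ≠ 0 →
      ‖K2 p a₁ a₂ a₃‖ ≤ 3 * p)
    (c : ℕ) [NeZero c] (hc : ∃ p k : ℕ, p.Prime ∧ c = p ^ k) (m₁ m₂ m₃ : ℤ) :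
    ‖K2 c (m₁ : ZMod c) (m₂ : ZMod c) (m₃ : ZMod c)‖ ≤
      c * (Nat.gcd (Nat.gcd (Nat.gcd m₁.natAbs m₂.natAbs) m₃.natAbs) c : ℝ) * d3 c := by
  obtain ⟨p, k, hp, rfl⟩ := hc
  haveI := Fact.mk hp
  have hp0 : (0 : ℝ) < p := by exact_mod_cast hp.pos
  have hp1 : (1 : ℝ) ≤ p := by exact_mod_cast hp.one_lt.le
  suffices key : ∀ (k : ℕ) (m₁ m₂ m₃ : ℤ),
      ‖K2 (p ^ k) (m₁ : ZMod (p ^ k)) (m₂ : ZMod (p ^ k)) (m₃ : ZMod (p ^ k))‖ ≤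
        ((p ^ k : ℕ) : ℝ) * (Nat.gcd (Nat.gcd (Nat.gcd m₁.natAbs m₂.natAbs) m₃.natAbs) (p ^ k) : ℝ) *
          d3 (p ^ k) from key k m₁ m₂ m₃
  intro k
  induction k using Nat.strong_induction_on with
  | _ k IH =>
  intro m₁ m₂ m₃
  have hg1 : 1 ≤ Nat.gcd (Nat.gcd (Nat.gcd m₁.natAbs m₂.natAbs) m₃.natAbs) (p ^ k) :=
    Nat.gcd_pos_of_pos_right _ (pow_pos hp.pos k)
  have hg1' : (1 : ℝ) ≤ (Nat.gcd (Nat.gcd (Nat.gcd m₁.natAbs m₂.natAbs) m₃.natAbs) (p ^ k) : ℝ) := by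
    exact_mod_cast hg1
  -- a bound `B ≤ p^k d₃(p^k)` suffices when the gcd factor is not used
  have hsuff : ∀ B : ℝ, ‖K2 (p ^ k) (m₁ : ZMod (p ^ k)) (m₂ : ZMod (p ^ k)) (m₃ : ZMod (p ^ k))‖ ≤ B →
      B ≤ ((p ^ k : ℕ) : ℝ) * d3 (p ^ k) →
      ‖K2 (p ^ k) (m₁ : ZMod (p ^ k)) (m₂ : ZMod (p ^ k)) (m₃ : ZMod (p ^ k))‖ ≤
        ((p ^ k : ℕ) : ℝ) * (Nat.gcd (Nat.gcd (Nat.gcd m₁.natAbs m₂.natAbs) m₃.natAbs) (p ^ k) : ℝ) *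
          d3 (p ^ k) := by
    intro B h1 h2
    refine h1.trans (h2.trans ?_)
    have h0 : (0 : ℝ) ≤ ((p ^ k : ℕ) : ℝ) * d3 (p ^ k) := by positivity
    calc ((p ^ k : ℕ) : ℝ) * d3 (p ^ k) = ((p ^ k : ℕ) : ℝ) * 1 * d3 (p ^ k) := by ring
      _ ≤ _ := by gcongr
  rcases (show k = 0 ∨ k = 1 ∨ 2 ≤ k by omega) with rfl | rfl | hk2
  · -- `k = 0`: modulus `1`
    refine hsuff _ (norm_K2_le_sq _ _ _ _) ?_
    rw [d3_prime_pow]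
    simp
  · -- `k = 1`: the prime case
    rw [norm_K2_intCast_congr (pow_one p)]
    have h := K2_bound_prime_of_nondegenerate (hD p) ((m₁ : ℤ) : ZMod p) ((m₂ : ℤ) : ZMod p)
      ((m₃ : ℤ) : ZMod p)
    refine h.trans (le_of_eq ?_)
    rw [pow_one]
    congr 2
    norm_cast
    refine gcd_prime_eq_of_dvd_iff hp ?_
    have hv : ∀ m : ℤ, p ∣ ((m : ℤ) : ZMod p).val ↔ p ∣ m.natAbs := by
      intro m
      rw [← Int.natCast_dvd, ← ZMod.intCast_zmod_eq_zero_iff_dvd]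
      constructor
      · intro hd
        have := Nat.eq_zero_of_dvd_of_lt hd (ZMod.val_lt _)
        rwa [ZMod.val_eq_zero] at this
      · intro h0
        rw [h0, ZMod.val_zero]
        exact dvd_zero p
    simp only [Nat.dvd_gcd_iff, hv]
  · -- `k ≥ 2`
    have hk0 : k ≠ 0 := by omega
    by_cases hall : p ∣ m₁.natAbs ∧ p ∣ m₂.natAbs ∧ p ∣ m₃.natAbs
    · -- imprimitive: (3.2) and induction
      obtain ⟨h1, h2, h3⟩ := hall
      obtain ⟨m₁', rfl⟩ : (p : ℤ) ∣ m₁ := Int.natCast_dvd.mpr h1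
      obtain ⟨m₂', rfl⟩ : (p : ℤ) ∣ m₂ := Int.natCast_dvd.mpr h2
      obtain ⟨m₃', rfl⟩ : (p : ℤ) ∣ m₃ := Int.natCast_dvd.mpr h3
      obtain ⟨n, rfl⟩ : ∃ n, k = n + 1 := ⟨k - 1, by omega⟩
      have hn : n ≠ 0 := by omega
      have hIH := IH n (by omega) m₁' m₂' m₃'
      have ecast : ∀ m' : ℤ, (((p : ℤ) * m' : ℤ) : ZMod (p ^ (n + 1))) =
          (p : ZMod (p ^ (n + 1))) * ((m' : ℤ) : ZMod (p ^ (n + 1))) := by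
        intro m'; push_cast; ring
      rw [ecast, ecast, ecast, K2_primePow_mul_prime hn, map_intCast, map_intCast, map_intCast,
        norm_mul, Complex.norm_pow, Complex.norm_natCast]
      have eg : Nat.gcd (Nat.gcd (Nat.gcd ((p : ℤ) * m₁').natAbs ((p : ℤ) * m₂').natAbs)
          ((p : ℤ) * m₃').natAbs) (p ^ (n + 1)) =
          p * Nat.gcd (Nat.gcd (Nat.gcd m₁'.natAbs m₂'.natAbs) m₃'.natAbs) (p ^ n) := by
        rw [Int.natAbs_mul, Int.natAbs_mul, Int.natAbs_mul, Int.natAbs_natCast, Nat.gcd_mul_left,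
          Nat.gcd_mul_left, pow_succ', Nat.gcd_mul_left]
      rw [eg]
      have hmono : (d3 (p ^ n) : ℝ) ≤ d3 (p ^ (n + 1)) := by
        exact_mod_cast d3_prime_pow_mono (p := p) (Nat.le_succ n)
      have hg0 : (0 : ℝ) ≤ (Nat.gcd (Nat.gcd (Nat.gcd m₁'.natAbs m₂'.natAbs) m₃'.natAbs) (p ^ n) : ℝ) := by
        positivity
      calc (p : ℝ) ^ 2 * ‖K2 (p ^ n) (m₁' : ZMod (p ^ n)) (m₂' : ZMod (p ^ n)) (m₃' : ZMod (p ^ n))‖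
          ≤ (p : ℝ) ^ 2 * (((p ^ n : ℕ) : ℝ) *
              (Nat.gcd (Nat.gcd (Nat.gcd m₁'.natAbs m₂'.natAbs) m₃'.natAbs) (p ^ n) : ℝ) * d3 (p ^ n)) := by
            gcongr
        _ ≤ (p : ℝ) ^ 2 * (((p ^ n : ℕ) : ℝ) *
              (Nat.gcd (Nat.gcd (Nat.gcd m₁'.natAbs m₂'.natAbs) m₃'.natAbs) (p ^ n) : ℝ) * d3 (p ^ (n + 1))) := by
            gcongr
        _ = ((p ^ (n + 1) : ℕ) : ℝ) *
              ((p * Nat.gcd (Nat.gcd (Nat.gcd m₁'.natAbs m₂'.natAbs) m₃'.natAbs) (p ^ n) : ℕ) : ℝ) *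
              d3 (p ^ (n + 1)) := by
            push_cast; ring
    · -- primitive
      set a₁ : ZMod (p ^ k) := ((m₁ : ℤ) : ZMod (p ^ k)) with ha₁
      set a₂ : ZMod (p ^ k) := ((m₂ : ℤ) : ZMod (p ^ k)) with ha₂
      set a₃ : ZMod (p ^ k) := ((m₃ : ℤ) : ZMod (p ^ k)) with ha₃
      have u1 : IsUnit a₁ ↔ ¬ p ∣ m₁.natAbs := isUnit_intCast_iff hk0 m₁
      have u2 : IsUnit a₂ ↔ ¬ p ∣ m₂.natAbs := isUnit_intCast_iff hk0 m₂
      have u3 : IsUnit a₃ ↔ ¬ p ∣ m₃.natAbs := isUnit_intCast_iff hk0 m₃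
      by_cases hunits : IsUnit a₁ ∧ IsUnit a₂ ∧ IsUnit a₃
      · obtain ⟨i1, i2, i3⟩ := hunits
        have h3 : (3 : ℝ) ≤ d3 (p ^ k) := by exact_mod_cast three_le_d3_prime_pow (p := p) (by omega)
        rcases Nat.even_or_odd' k with ⟨l, hl | hl⟩
        · -- even
          refine hsuff _ (norm_K2_even_primePow_le (p := p) (l := l) (m := k) (by omega) a₁ a₂ a₃ i1 i2 i3) ?_
          push_cast
          nlinarith [pow_pos hp0 k]
        · -- odd, `k = 2l + 1`, `l ≥ 1`
          subst hl
          have hl1 : 1 ≤ l := by omega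
          by_cases hp23 : p ≠ 2 ∧ p ≠ 3
          · refine hsuff _ (norm_K2_odd_primePow_le hp23.1 hp23.2 hl1 a₁ a₂ a₃ i1 i2 i3) ?_
            push_cast
            nlinarith [pow_pos hp0 (2 * l + 1)]
          · have hp3 : (p : ℝ) ≤ 3 := by
              rcases not_and_or.mp hp23 with h | h
              · rw [not_ne_iff.mp h]; norm_num
              · rw [not_ne_iff.mp h]; norm_num
            have h10 : (10 : ℝ) ≤ d3 (p ^ (2 * l + 1)) := by
              exact_mod_cast ten_le_d3_prime_pow (p := p) (by omega)
            refine hsuff _ (norm_K2_odd_primePow_le_crude hl1 a₁ a₂ a₃ i1 i2) ?_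
            push_cast
            have e : (p : ℝ) ^ (2 * l + 2) = p * p ^ (2 * l + 1) := by ring
            rw [e]
            nlinarith [pow_pos hp0 (2 * l + 1)]
      · -- mixed: (3.3)
        have hcase : (IsUnit a₁ ∧ ¬ IsUnit a₃) ∨ (¬ IsUnit a₁ ∧ IsUnit a₃) ∨
            (IsUnit a₂ ∧ ¬ IsUnit a₃) ∨ (¬ IsUnit a₂ ∧ IsUnit a₃) := by
          rw [u1, u2, u3] at hunits ⊢
          tauto
        rw [K2_primePow_eq_zero_of_degenerate hk2 a₁ a₂ a₃ hcase, norm_zero]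
        positivity



/-- **(3.1) for every modulus from Deligne's bound at primes**: twisted multiplicativity
(`K2_bound_of_primePow`) and `K2_bound_primePow_of_deligne`. [cite: HeathBrown1986d3, §3 (3.1)] -/
theorem K2_bound_of_deligne
    (hD : ∀ (p : ℕ) [Fact p.Prime] (a₁ a₂ a₃ : ZMod p), a₁ ≠ 0 → a₂ ≠ 0 → a₃ ≠ 0 →
      ‖K2 p a₁ a₂ a₃‖ ≤ 3 * p)
    (c : ℕ) [NeZero c] (a₁ a₂ a₃ : ZMod c) :
    ‖K2 c a₁ a₂ a₃‖ ≤ c * (Nat.gcd (Nat.gcd (Nat.gcd a₁.val a₂.val) a₃.val) c : ℝ) * d3 c :=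
  K2_bound_zmod_of_int (K2_bound_of_primePow
    (fun c _ hc m₁ m₂ m₃ => K2_bound_primePow_of_deligne hD c hc m₁ m₂ m₃) c) a₁ a₂ a₃

end HeathBrown1986

/-- **Fouvry–Tenenbaum Lemma 4.13 at every level `θ < 1/2`, conditionally on Deligne's bound for the
nondegenerate hyper-Kloosterman sum `K₂` at primes only** (`|K₂(a₁, a₂, a₃; p)| ≤ 3p` for
`p ∤ a₁a₂a₃`, [Deligne, SGA 4½, Sommes trig. Thm 7.4]; Heath-Brown's (3.1) is then a theorem:
`HeathBrown1986.K2_bound_of_deligne`).  This is Heath-Brown's Theorem 1 route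
[cite: HeathBrown1986d3, §§3, 6] up to level `1/2`; the printed level `1/2 + 1/85` (resp. HB's
`1/2 + 1/42` for `D = 1`) additionally needs the Birch–Bombieri bound of §4 (Lemma 5), also a
consequence of Deligne's theorem. [cite: FouvryTenenbaum2021, Lemma 4.13] -/
theorem FouvryTenenbaum2021_lemma413_of_deligne
    (hD : ∀ (p : ℕ) [Fact p.Prime] (a₁ a₂ a₃ : ZMod p), a₁ ≠ 0 → a₂ ≠ 0 → a₃ ≠ 0 →
      ‖HeathBrown1986.K2 p a₁ a₂ a₃‖ ≤ 3 * p)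
    {θ : ℝ} (hθ : θ < 1 / 2) :
    ∃ δ C₀ C : ℝ, 0 < δ ∧ ∀ x : ℝ, 1 ≤ x → ∀ M₁ M₂ M₃ lo₁ hi₁ lo₂ hi₂ lo₃ hi₃ : ℝ,
      x ^ (1 / 100 : ℝ) ≤ M₁ → M₁ ≤ M₂ → M₂ ≤ M₃ → M₁ * M₂ * M₃ ≤ x →
      M₁ ≤ lo₁ → hi₁ ≤ 2 * M₁ → M₂ ≤ lo₂ → hi₂ ≤ 2 * M₂ → M₃ ≤ lo₃ → hi₃ ≤ 2 * M₃ →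
      ∀ (s D : ℕ) (a t₁ t₂ t₃ : ℤ), 1 ≤ s → (s : ℝ) ≤ x ^ θ → 1 ≤ D →
        IsCoprime (s : ℤ) (a * D) → IsCoprime (t₁ * t₂ * t₃) (D : ℤ) →
        |∑ m₁ ∈ (Ioc ⌊lo₁⌋₊ ⌊hi₁⌋₊).filter (fun m : ℕ => (m : ZMod D) = (t₁ : ZMod D)),
            ∑ m₂ ∈ (Ioc ⌊lo₂⌋₊ ⌊hi₂⌋₊).filter (fun m : ℕ => (m : ZMod D) = (t₂ : ZMod D)),
              ∑ m₃ ∈ (Ioc ⌊lo₃⌋₊ ⌊hi₃⌋₊).filter (fun m : ℕ => (m : ZMod D) = (t₃ : ZMod D)),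
                FouvryTenenbaum2021.gAP s a (m₁ * m₂ * m₃)| ≤
          C * (D : ℝ) ^ C₀ * x ^ (1 - δ) / (Nat.totient s : ℝ) :=
  FouvryTenenbaum2021_lemma413_of_K2_bound_primePow
    (fun c _ hc m₁ m₂ m₃ => HeathBrown1986.K2_bound_primePow_of_deligne hD c hc m₁ m₂ m₃) hθ

end Literature.NumberTheory.Sieve

end
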